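import Summits.QuantumFields.YangMills.Theorems.BalabanUVNodesN15CovariantLandauTwoGridLocal
import Summits.QuantumFields.YangMills.Theorems.BalabanUVNodesN15CovariantLandauGreenStepRow
import HarnessLib

/-!
# Route «BalabanUVNodes», node N15 = NE2, road (c) — PROGRAMME (P-S), XXIX: THE TWO-GRID η-DEFECT OF THE COVARIANT `G′(T)` FROM THE FLAT TWO-GRID KERNEL ROWS OF `G′(1)`, `G′(1)∂ᵀ`,
# THE OSCILLATION LETTERS OF THE TRANSPORTERS AND THE ONE-GRID ROWS ONLY (Neumann on the fine step, `T4EtaRateDefect.idef_fix`) (dag-n15-c g24, n15-c∕236; HOME HANDOFF «(G3)»)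

Cell `pub-ymgap`, seat `pub-ymgap-dag-n15-c` (generation g24; R134 (a), s1; HUMAN RULING D-0062; chair R424 venue).  `bears_on: R4∕N15 · K3⁸ SpineGivenEndpointR13SepCoPHV
(stmt-QuantumFields-27366)`; filed `--supports stmt-QuantumFields-27366 --as helper` — COUNT-NEUTRAL.  Theorems only; 0 `sorry`.  Imports BY NAME n15-c∕235 (`idef_sDiag`, `idef_bContr_transpose`,
`hasMaj_idef_bMulShift_comp`, `hasMaj_sDiag_pull`, `hasMaj_bContr_transpose_pull`), 236a (`hasMaj_cGreen_one_mul_claplA_sub`, `mulVecLin_cGreen_eq_one_add_step_comp`, `cGreen_one_mul_claplA_sub_eq`,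
`bMulShift_transpose_mul_bMulShift`), 224–229 (local operators and rows), 215 (averaging rows), lit-balaban∕b11 (`neumann_majorant`, `hasMaj_comp_exp`), the T⁴ cell (`idef_fix`, `idef_comp`).
Nothing in the tree is modified.

THE MECHANISM.  Coarse `G′(T) = G′(1) + K·G′(T)`, fine `G′(T′) = G′(1)′ + K′·G′(T′)` (236a), `K = [G′(1)∂ᵀ]B + G′(1)(Bᵀ∂) − G′(1)(BᵀB) + aG′(1)𝒬` (`B = ∂ − D_T = 𝔇_NS`, `N = n(1 − T)`, `𝒬 = Q₁ᵀQ₁ − Q_TᵀQ_T`).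
`idef_fix`: the defect `𝔇 = G′(T′)P̂ − P̂G′(T)` solves `𝔇 = [𝔇(G′(1)′, G′(1)) + 𝔇(K′, K)·G′(T)] + K′·𝔇` — a Neumann fixed point with the FINE step.  Every word of `𝔇(K′,K)·G′(T)` is (flat kernel)·(local
letter)·G′(T) with the derivatives GLUED to the kernels (`G′(1)∂ᵀ`, and `Bᵀ∂ = 𝔰_{(div N)ᵀ} − ∂ᵀℭ_Nᵀ`, `BᵀB = 𝔰_m`): by Leibniz (`idef_comp`) each contributes (i) the fine kernel times the EXACT
intertwining defect of the local letter (n15-c∕235: an oscillation multiplier after the pull-back; for the shifted `B` also `n⁻¹·𝔇·P̂·∂G′(T)` — ONE coarse gradient row `C_Y`), and (ii) the FLAT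
two-grid kernel row (`ε_G`, `ε_A`) times a coarse one-grid row.  No derivative ever meets a pulled-back field; no second derivative of a propagator appears.
* ★★★ **`hasMaj_idef_cGreen_of_flat`**: `𝔇(G′(T′), G′(T)) ≤ E·(1 − θ′_Kc)⁻¹·e^{−(δ−2s)d}`, `E` = `ε_G` + ten explicit word constants (docstring of the theorem), `θ′_K` = 236a's step constant
  on the fine grid.  Inputs: flat one-grid rows `C_G′, C_A′` (fine), the propagator rows `C_X` (228) and `C_Y` (229) (coarse), flat two-grid rows `ε_G` (`G′(1)`), `ε_A` (`G′(1)∂ᵀ`),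
  oscillation letters `ω_N` (of `N′` against `N∘pr`, rows and columns), `ω_V` (of `(div N)ᵀ`), `ω_m` (of `m`), the averaging word's two-grid row `φ_Q` (block-diagonal), transporter letters.

HONEST FRAMING ∕ LIMITS.  Bookkeeping over displayed rows; the flat one-grid and two-grid kernel rows are HYPOTHESES (the one-grid ones are theorems on King's torus family, n15-c∕220; the
two-grid ones are the located flat analytic input of (G3)); MODEL carriers; NOT [Balaban1985BackgroundPropagators] Lemma 3.3 ∕ Thm 3.4 ∕ (3.49) as printed; NE2⁺ NOT PRINTED; N15 of record
untouched (DISCHARGED AS CONSUMED, p687738); counts UNMOVED (typed 28∕28 · discharged 8∕27); one finite 𝕋⁴ at fixed ε per index — NOT infinite volume ∕ OS ∕ mass gap ∕ Clay.  Restate-immune.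
-/

noncomputable section

open scoped BigOperators Matrix
open Finset

namespace Summit.QuantumFields.YangMills.BalabanUVNodes.N15.CovLandau

open Literature.MathematicalPhysics.QuantumFieldTheory.Balaban1983to89
open Literature.MathematicalPhysics.QuantumFieldTheory.Balaban1983to89.B5Prop11Plancherel (Tor fine unitVec)
open Literature.MathematicalPhysics.QuantumFieldTheory.Balaban1983to89.B11SectG (BlockNorm HasMaj RowSum hasMaj_comp_exp neumann_majorant)
open Literature.MathematicalPhysics.QuantumFieldTheory.Balaban1983to89.B6UnitTorusCarrier (unitTorusGeo rowSum_unitTorusGeo triangle254_unitTorusGeo unitTorusGeo_dist_nonneg)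
open Literature.MathematicalPhysics.QuantumFieldTheory.Balaban1983to89.T4EtaRateDefect (idef idef_apply idef_comp idef_add idef_sub idef_fix)
open Literature.MathematicalPhysics.QuantumFieldTheory.Balaban1983to89.T4EtaRateCoeffDefect (pull pull_apply)
open Literature.MathematicalPhysics.QuantumFieldTheory.King1986.Torus (blockOf tdistT tdistT_nonneg tdistT_symm tdistT_self)
open Summit.QuantumFields.YangMills.BalabanUVNodes.N15.MatrixSpecies (liftBlk liftMap)
open Summit.QuantumFields.YangMills.BalabanUVNodes.N15.VectorPiece (kingPr kingPrV)
open Summit.QuantumFields.YangMills.BalabanUVNodes.N15.CovAvg (cvaStair cvaStair_one rows_one)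
open Summit.QuantumFields.YangMills.BalabanUVNodes.N15.BackgroundModel (kappa_ofBlocks)
open Summit.QuantumFields.YangMills.BalabanUVNodes.N15.DerivDefect (exists_const_hasMaj_ofBlocks)
open Summit.QuantumFields.YangMills.BalabanUVNodes.N15.TwoGrid (hasMaj_smul_ofBlocks)
open Summit.QuantumFields.YangMills.BalabanUVNodes.N15.BlockRows (hasMaj_comp_localRight hasMaj_comp_localLeft)

variable {d : ℕ}

/-! ## §1 Three letter-level bookkeeping lemmas -/

section Letters

variable {ι : Type} [Fintype ι]

/-- rows of `AᵀB` from the columns of `A` and the rows of `B`. [folklore] -/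
theorem rows_transpose_mul_le {A B : Matrix ι ι ℝ} {ca rb : ℝ} (hrb : 0 ≤ rb) (hA : ∀ i, ∑ l, |A l i| ≤ ca) (hB : ∀ l, ∑ j, |B l j| ≤ rb) (i : ι) :
    ∑ j, |(Aᵀ * B) i j| ≤ ca * rb := by
  calc ∑ j, |(Aᵀ * B) i j| = ∑ j, |∑ l, A l i * B l j| := by simp only [Matrix.mul_apply, Matrix.transpose_apply]
    _ ≤ ∑ j, ∑ l, |A l i| * |B l j| := Finset.sum_le_sum fun j _ => (Finset.abs_sum_le_sum_abs _ _).trans (le_of_eq (Finset.sum_congr rfl fun l _ => abs_mul _ _))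
    _ = ∑ l, |A l i| * ∑ j, |B l j| := by rw [Finset.sum_comm]; simp only [Finset.mul_sum]
    _ ≤ ∑ l, |A l i| * rb := Finset.sum_le_sum fun l _ => mul_le_mul_of_nonneg_left (hB l) (abs_nonneg _)
    _ = (∑ l, |A l i|) * rb := by rw [Finset.sum_mul]
    _ ≤ ca * rb := mul_le_mul_of_nonneg_right (hA i) hrb

variable (M : Fin (d + 1) → ℕ) [∀ μ, NeZero (M μ)] (n : ℕ) [NeZero n]

omit [∀ μ, NeZero (M μ)] [NeZero n] in
/-- rows of the site multiplier `m(z) = Σ_μ N_μ(z − e_μ)ᵀN_μ(z − e_μ)` of `BᵀB`: `≤ (d+1)·w′·w` (column and row letters of `N`). [folklore] -/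
theorem rows_mLetter_le (N : Fin (d + 1) → Tor (fine n M) → Matrix ι ι ℝ) {w w' : ℝ} (hw0 : 0 ≤ w) (hw : ∀ μ x i, ∑ j, |N μ x i j| ≤ w) (hw' : ∀ μ x i, ∑ j, |N μ x j i| ≤ w')
    (z : Tor (fine n M)) (i : ι) : ∑ j, |(fun z => ∑ μ, (N μ (z - unitVec (fine n M) μ))ᵀ * N μ (z - unitVec (fine n M) μ)) z i j| ≤ ((d : ℝ) + 1) * (w' * w) := by
  calc ∑ j, |(fun z => ∑ μ, (N μ (z - unitVec (fine n M) μ))ᵀ * N μ (z - unitVec (fine n M) μ)) z i j|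
      = ∑ j, |∑ μ, ((N μ (z - unitVec (fine n M) μ))ᵀ * N μ (z - unitVec (fine n M) μ)) i j| := by simp only [Matrix.sum_apply]
    _ ≤ ∑ j, ∑ μ, |((N μ (z - unitVec (fine n M) μ))ᵀ * N μ (z - unitVec (fine n M) μ)) i j| := Finset.sum_le_sum fun j _ => Finset.abs_sum_le_sum_abs _ _
    _ = ∑ μ, ∑ j, |((N μ (z - unitVec (fine n M) μ))ᵀ * N μ (z - unitVec (fine n M) μ)) i j| := Finset.sum_comm
    _ ≤ ∑ _μ : Fin (d + 1), w' * w := Finset.sum_le_sum fun μ _ => rows_transpose_mul_le hw0 (fun i' => hw' μ _ i') (fun l => hw μ _ l) i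
    _ = ((d : ℝ) + 1) * (w' * w) := by rw [Finset.sum_const, Finset.card_univ, Fintype.card_fin, nsmul_eq_mul]; push_cast; ring

omit [Fintype ι] [∀ μ, NeZero (M μ)] [NeZero n] in
/-- `S = 𝔇_1S`. [folklore] -/
theorem bShift_eq_bMulShift_one [DecidableEq ι] : bShift M n (ι := ι) = bMulShift M n (fun (_ : Fin (d + 1)) (_ : Tor (fine n M)) => (1 : Matrix ι ι ℝ)) := by
  ext p q
  simp only [bShift, bMulShift, Matrix.one_apply]
  by_cases h : q.1 = p.1.1 + unitVec (fine n M) p.1.2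
  · rw [if_pos h, if_pos h]
    by_cases h2 : q.2 = p.2
    · rw [if_pos h2, if_pos h2.symm]
    · rw [if_neg h2, if_neg (Ne.symm h2)]
  · rw [if_neg h, if_neg h]

end Letters

/-! ## §2 The two-grid η-defect of `G′(T)` -/

section Defect

variable (M : Fin (d + 1) → ℕ) [∀ μ, NeZero (M μ)] {ι : Type} [Fintype ι] [DecidableEq ι] (L k m : ℕ) [NeZero L]

set_option maxHeartbeats 1600000 in
/-- ★★★ **THE TWO-GRID η-DEFECT OF THE COVARIANT `G′(T)` FROM FLAT TWO-GRID KERNEL ROWS, OSCILLATION LETTERS AND ONE-GRID ROWS ONLY.**  Coarse grid `n = L^k` (transporters `T`, mass `a`),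
fine grid `n′ = L^mL^k` (`T′`, `a′`), King's pull-backs `P̂_S`, `P̂_V`.  Inputs: (one-grid, coarse) `G′(T) ≤ C_Xe^{−δd}` (n15-c∕228), `∂G′(T) ≤ C_Ye^{−δd}` (n15-c∕229), letters `ρ` (rows∕cols of
`T − 1`), `λ′` (column Lipschitz), `σ, τ`; (one-grid, fine) flat `G′(1)′ ≤ C_G′`, `G′(1)′∂′ᵀ ≤ C_A′`, letters `ρ₁, λ₁, σ₁, τ₁` and the step smallness `θ′_Kc < 1` (236a); (two-grid) the FLAT kernel
rows `ε_G` (`G′(1)′P̂_S − P̂_SG′(1)`), `ε_A` (`G′(1)′∂′ᵀP̂_V − P̂_SG′(1)∂ᵀ`), the oscillations `ω_N` (rows and columns of `N′ − N∘pr`, `N = n(1−T)`), `ω_V` (of `(div_n N)ᵀ`), `ω_m` (of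
`m = Σ_μ N_μ(·−e_μ)ᵀN_μ(·−e_μ)`), and the block-diagonal two-grid row `φ_Q` of the averaging word `a(Q₁ᵀQ₁ − Q_TᵀQ_T)`.  Output:
`G′(T′)P̂_S − P̂_SG′(T) ≤ E(1 − θ′_Kc)⁻¹e^{−(δ−2s)d}` with `E = ε_G + C_A′(ω_N e^{δ+s}C_Xc + n⁻¹(n′ρ₁)C_Y)c + ε_A(nρe^{δ+s}C_Xc)c + C_G′ω_VC_Xc + ε_G(d+1)n(nλ′)C_Xc + C_A′ω_NC_Xc + ε_A(nρ)C_Xc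
+ C_G′ω_mC_Xc + ε_G(d+1)(nρ)²C_Xc + C_G′φ_QC_Xc + ε_G|a|n^{−(d+1)}(στ+σ)C_Xc`.
[cite: Balaban1985BackgroundPropagators, Thm 3.4 p.400 + Lemma 3.3 (3.55)–(3.62) p.402 (the covariant perturbation words), Thm 3.14 pp.426–427 (two spacings: mechanism); King1986, p.664 + Prop. 3.9 (3.73) p.665 (pairing, shape of the η-rate);
Balaban1985Variational, (187)–(190) p.308 (Neumann)] -/
theorem hasMaj_idef_cGreen_of_flat
    {T : Fin (d + 1) → Tor (fine (L ^ k) M) → Matrix ι ι ℝ} (hT : ∀ ν x, IsUnit (T ν x)) {a : ℝ} (ha : 0 < a)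
    {T' : Fin (d + 1) → Tor (fine (L ^ m * L ^ k) M) → Matrix ι ι ℝ} (hT' : ∀ ν x, IsUnit (T' ν x)) {a' : ℝ} (ha' : 0 < a')
    {δ s c CX CY CG₁ CA₁ ρ lam σ τ ρ₁ lam₁ σ₁ τ₁ εG εA ωN ωV ωm φQ : ℝ} (hs : 0 < s) (hsδ : 2 * s ≤ δ) (hrow : RowSum (unitTorusGeo L k M) s c) (hc : 0 ≤ c)
    (hCX : 0 ≤ CX) (hCY : 0 ≤ CY) (hCG₁ : 0 ≤ CG₁) (hCA₁ : 0 ≤ CA₁) (hρ0 : 0 ≤ ρ) (hlam0 : 0 ≤ lam) (hσ0 : 0 ≤ σ) (hτ0 : 0 ≤ τ) (hρ₁0 : 0 ≤ ρ₁) (hlam₁0 : 0 ≤ lam₁) (hσ₁0 : 0 ≤ σ₁) (hτ₁0 : 0 ≤ τ₁)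
    (hεG : 0 ≤ εG) (hεA : 0 ≤ εA) (hωN0 : 0 ≤ ωN) (hωV0 : 0 ≤ ωV) (hωm0 : 0 ≤ ωm) (hφQ0 : 0 ≤ φQ)
    -- coarse transporter letters
    (hρr : ∀ ν x i, ∑ j, |(T ν x - (fun (_ : Fin (d + 1)) (_ : Tor (fine (L ^ k) M)) => (1 : Matrix ι ι ℝ)) ν x) i j| ≤ ρ)
    (hρc : ∀ ν x j, ∑ i, |(T ν x - (fun (_ : Fin (d + 1)) (_ : Tor (fine (L ^ k) M)) => (1 : Matrix ι ι ℝ)) ν x) i j| ≤ ρ)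
    (hlamc : ∀ μ (z : Tor (fine (L ^ k) M)) i, ∑ j, |(T μ z - T μ (z - unitVec (fine (L ^ k) M) μ)) j i| ≤ lam)
    (hσr : ∀ y aa i, ∑ j, |(cvaStair M (L ^ k) (fun μ b => T μ b.1) y aa 0 - cvaStair M (L ^ k) (fun μ b => (fun (_ : Fin (d + 1)) (_ : Tor (fine (L ^ k) M)) => (1 : Matrix ι ι ℝ)) μ b.1) y aa 0) i j| ≤ σ)
    (hσc : ∀ y aa j, ∑ i, |(cvaStair M (L ^ k) (fun μ b => T μ b.1) y aa 0 - cvaStair M (L ^ k) (fun μ b => (fun (_ : Fin (d + 1)) (_ : Tor (fine (L ^ k) M)) => (1 : Matrix ι ι ℝ)) μ b.1) y aa 0) i j| ≤ σ)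
    (hτr : ∀ y aa i, ∑ j, |cvaStair M (L ^ k) (fun μ b => T μ b.1) y aa 0 i j| ≤ τ)
    -- fine transporter letters
    (hρr' : ∀ ν x i, ∑ j, |(T' ν x - (fun (_ : Fin (d + 1)) (_ : Tor (fine (L ^ m * L ^ k) M)) => (1 : Matrix ι ι ℝ)) ν x) i j| ≤ ρ₁)
    (hρc' : ∀ ν x j, ∑ i, |(T' ν x - (fun (_ : Fin (d + 1)) (_ : Tor (fine (L ^ m * L ^ k) M)) => (1 : Matrix ι ι ℝ)) ν x) i j| ≤ ρ₁)
    (hlamc' : ∀ μ (z : Tor (fine (L ^ m * L ^ k) M)) i, ∑ j, |(T' μ z - T' μ (z - unitVec (fine (L ^ m * L ^ k) M) μ)) j i| ≤ lam₁)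
    (hσr' : ∀ y aa i, ∑ j, |(cvaStair M (L ^ m * L ^ k) (fun μ b => T' μ b.1) y aa 0 - cvaStair M (L ^ m * L ^ k) (fun μ b => (fun (_ : Fin (d + 1)) (_ : Tor (fine (L ^ m * L ^ k) M)) => (1 : Matrix ι ι ℝ)) μ b.1) y aa 0) i j| ≤ σ₁)
    (hσc' : ∀ y aa j, ∑ i, |(cvaStair M (L ^ m * L ^ k) (fun μ b => T' μ b.1) y aa 0 - cvaStair M (L ^ m * L ^ k) (fun μ b => (fun (_ : Fin (d + 1)) (_ : Tor (fine (L ^ m * L ^ k) M)) => (1 : Matrix ι ι ℝ)) μ b.1) y aa 0) i j| ≤ σ₁)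
    (hτr' : ∀ y aa i, ∑ j, |cvaStair M (L ^ m * L ^ k) (fun μ b => T' μ b.1) y aa 0 i j| ≤ τ₁)
    -- coarse propagator rows (n15-c∕228, 229)
    (hX : HasMaj (BlockNorm.ofBlocks (unitTorusGeo L k M) (liftBlk (blockOf (L ^ k) M) ι)) (BlockNorm.ofBlocks (unitTorusGeo L k M) (liftBlk (blockOf (L ^ k) M) ι)) (Matrix.mulVecLin (cGreen M (L ^ k) T a)) (fun y y' => CX * Real.exp (-(δ * tdistT M y y'))))
    (hY : HasMaj (BlockNorm.ofBlocks (unitTorusGeo L k M) (liftBlk (blockOf (L ^ k) M) ι)) (BlockNorm.ofBlocks (unitTorusGeo L k M) (liftBlk (fun b : Tor (fine (L ^ k) M) × Fin (d + 1) => blockOf (L ^ k) M b.1) ι)) (Matrix.mulVecLin ((cgrad M (L ^ k) (fun (_ : Fin (d + 1)) (_ : Tor (fine (L ^ k) M)) => (1 : Matrix ι ι ℝ))) * (cGreen M (L ^ k) T a))) (fun y y' => CY * Real.exp (-(δ * tdistT M y y'))))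
    -- fine flat one-grid rows
    (hG1' : HasMaj (BlockNorm.ofBlocks (unitTorusGeo L k M) (liftBlk (blockOf (L ^ m * L ^ k) M) ι)) (BlockNorm.ofBlocks (unitTorusGeo L k M) (liftBlk (blockOf (L ^ m * L ^ k) M) ι)) (Matrix.mulVecLin (cGreen M (L ^ m * L ^ k) (fun (_ : Fin (d + 1)) (_ : Tor (fine (L ^ m * L ^ k) M)) => (1 : Matrix ι ι ℝ)) a')) (fun y y' => CG₁ * Real.exp (-(δ * tdistT M y y'))))
    (hA1' : HasMaj (BlockNorm.ofBlocks (unitTorusGeo L k M) (liftBlk (fun b : Tor (fine (L ^ m * L ^ k) M) × Fin (d + 1) => blockOf (L ^ m * L ^ k) M b.1) ι)) (BlockNorm.ofBlocks (unitTorusGeo L k M) (liftBlk (blockOf (L ^ m * L ^ k) M) ι)) (Matrix.mulVecLin ((cGreen M (L ^ m * L ^ k) (fun (_ : Fin (d + 1)) (_ : Tor (fine (L ^ m * L ^ k) M)) => (1 : Matrix ι ι ℝ)) a') * ((cgrad M (L ^ m * L ^ k) (fun (_ : Fin (d + 1)) (_ : Tor (fine (L ^ m * L ^ k) M)) => (1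 : Matrix ι ι ℝ))))ᵀ)) (fun y y' => CA₁ * Real.exp (-(δ * tdistT M y y'))))
    -- flat two-grid kernel rows
    (hDG : HasMaj (BlockNorm.ofBlocks (unitTorusGeo L k M) (liftBlk (blockOf (L ^ k) M) ι)) (BlockNorm.ofBlocks (unitTorusGeo L k M) (liftBlk (blockOf (L ^ m * L ^ k) M) ι)) (idef (pull (liftMap (kingPr L k m M) ι)) (pull (liftMap (kingPr L k m M) ι)) (Matrix.mulVecLin (cGreen M (L ^ m * L ^ k) (fun (_ : Fin (d + 1)) (_ : Tor (fine (L ^ m * L ^ k) M)) => (1 : Matrix ι ι ℝ)) a')) (Matrix.mulVecLin (cGreen M (L ^ k) (fun (_ : Fin (d + 1)) (_ : Tor (fine (L ^ k) M)) => (1 : Matrix ι ι ℝ)) a))) (fun y y' => εG * Real.exp (-(δ * tdistT M y y'))))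
    (hDA : HasMaj (BlockNorm.ofBlocks (unitTorusGeo L k M) (liftBlk (fun b : Tor (fine (L ^ k) M) × Fin (d + 1) => blockOf (L ^ k) M b.1) ι)) (BlockNorm.ofBlocks (unitTorusGeo L k M) (liftBlk (blockOf (L ^ m * L ^ k) M) ι)) (idef (pull (liftMap (kingPrV L k m M) ι)) (pull (liftMap (kingPr L k m M) ι)) (Matrix.mulVecLin ((cGreen M (L ^ m * L ^ k) (fun (_ : Fin (d + 1)) (_ : Tor (fine (L ^ m * L ^ k) M)) => (1 : Matrix ι ι ℝ)) a') * ((cgrad M (L ^ m * L ^ k) (fun (_ : Fin (d + 1)) (_ : Tor (fine (L ^ m * L ^ k) M)) => (1 : Matrix ι ι ℝ))))ᵀ)) (Matrix.mulVecLin ((cGreen M (L ^ k) (fun (_ : Fin (d + 1)) (_ : Tor (fine (L ^ k) M)) => (1 : Matrix ι ι ℝ)) a) * ((cgrad M (L ^ k) (fun (_ : Fin (d + 1)) (_ : Tor (fine (L ^ k) M)) => (1 : Matrix ι ι ℝ))))ᵀ))) (fun y y' => εA * Real.exp (-(δ * tdistT M y y'))))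
    -- oscillation letters
    (hωNr : ∀ ν x' i, ∑ j, |((fun ν x => (((L ^ m * L ^ k : ℕ) : ℝ)) • ((1 : Matrix ι ι ℝ) - T' ν x)) ν x' - (fun ν x => (((L ^ k : ℕ) : ℝ)) • ((1 : Matrix ι ι ℝ) - T ν x)) ν (kingPr L k m M x')) i j| ≤ ωN)
    (hωNc : ∀ ν x' i, ∑ j, |((fun ν x => (((L ^ m * L ^ k : ℕ) : ℝ)) • ((1 : Matrix ι ι ℝ) - T' ν x)) ν x' - (fun ν x => (((L ^ k : ℕ) : ℝ)) • ((1 : Matrix ι ι ℝ) - T ν x)) ν (kingPr L k m M x')) j i| ≤ ωN)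
    (hωV : ∀ x' i, ∑ j, |((fun z => (bDiv M (L ^ m * L ^ k) (fun ν x => (((L ^ m * L ^ k : ℕ) : ℝ)) • ((1 : Matrix ι ι ℝ) - T' ν x)) z)ᵀ) x' - (fun z => (bDiv M (L ^ k) (fun ν x => (((L ^ k : ℕ) : ℝ)) • ((1 : Matrix ι ι ℝ) - T ν x)) z)ᵀ) (kingPr L k m M x')) i j| ≤ ωV)
    (hωm : ∀ x' i, ∑ j, |((fun z => ∑ μ, ((fun ν x => (((L ^ m * L ^ k : ℕ) : ℝ)) • ((1 : Matrix ι ι ℝ) - T' ν x)) μ (z - unitVec (fine (L ^ m * L ^ k) M) μ))ᵀ * (fun ν x => (((L ^ m * L ^ k : ℕ) : ℝ)) • ((1 : Matrix ι ι ℝ) - T' ν x)) μ (z - unitVec (fine (L ^ m * L ^ k) M) μ)) x' - (fun z => ∑ μ, ((fun ν x => (((L ^ k : ℕ) : ℝ)) • ((1 : Matrix ι ι ℝ) - T ν x)) μ (z - unitVec (fine (L ^ k) M) μ))ᵀ * (fun ν x => (((L ^ k : ℕ) : ℝ)) • ((1 : Matrix ι ι ℝ) - T ν x)) μ (z - unitVec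 (fine (L ^ k) M) μ)) (kingPr L k m M x')) i j| ≤ ωm)
    (hDQ : HasMaj (BlockNorm.ofBlocks (unitTorusGeo L k M) (liftBlk (blockOf (L ^ k) M) ι)) (BlockNorm.ofBlocks (unitTorusGeo L k M) (liftBlk (blockOf (L ^ m * L ^ k) M) ι)) (idef (pull (liftMap (kingPr L k m M) ι)) (pull (liftMap (kingPr L k m M) ι)) (Matrix.mulVecLin (a' • (((csavg M (L ^ m * L ^ k) (fun (_ : Fin (d + 1)) (_ : Tor (fine (L ^ m * L ^ k) M)) => (1 : Matrix ι ι ℝ))))ᵀ * (csavg M (L ^ m * L ^ k) (fun (_ : Fin (d + 1)) (_ : Tor (fine (L ^ m * L ^ k) M)) => (1 : Matrix ι ι ℝ))) - ((csavg M (L ^ m * L ^ k) T'))ᵀ * (csavg M (L ^ m * L ^ k) T')))) (Matrix.mulVecLin (a • (((csavg M (L ^ k) (fun (_ : Fin (d + 1)) (_ : Tor (fine (L ^ k) M)) => (1 : Matrix ι ι ℝ))))ᵀ * (csavg M (L ^ k) (fun (_ : Fin (d + 1)) (_ : Tor (fine (L ^ k) M)) => (1 : Matrix ι ι ℝ)))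 - ((csavg M (L ^ k) T))ᵀ * (csavg M (L ^ k) T))))) (fun y y' => if y = y' then φQ else 0))
    -- smallness of the fine step (236a's constant)
    (hq' : (CA₁ * ((((L ^ m * L ^ k : ℕ) : ℝ)) * ρ₁ * Real.exp δ) * c + CG₁ * (((d : ℝ) + 1) * (((L ^ m * L ^ k : ℕ) : ℝ)) * ((((L ^ m * L ^ k : ℕ) : ℝ)) * lam₁)) + CA₁ * ((((L ^ m * L ^ k : ℕ) : ℝ)) * ρ₁) + CG₁ * (((((L ^ m * L ^ k : ℕ) : ℝ)) * ((d + 1 : ℕ) * ρ₁) * Real.exp (δ + s)) * ((((L ^ m * L ^ k : ℕ) : ℝ)) * ρ₁ * Real.exp (δ + s)) * c) * c + |a'| * (((((L ^ m * L ^ k : ℕ) : ℝ)) ^ (d + 1))⁻¹ * CG₁ * (σ₁ * τ₁ + σ₁))) * c < 1) :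
    HasMaj (BlockNorm.ofBlocks (unitTorusGeo L k M) (liftBlk (blockOf (L ^ k) M) ι)) (BlockNorm.ofBlocks (unitTorusGeo L k M) (liftBlk (blockOf (L ^ m * L ^ k) M) ι)) (idef (pull (liftMap (kingPr L k m M) ι)) (pull (liftMap (kingPr L k m M) ι)) (Matrix.mulVecLin (cGreen M (L ^ m * L ^ k) T' a')) (Matrix.mulVecLin (cGreen M (L ^ k) T a)))
      (fun y y' => (εG + CA₁ * (ωN * (Real.exp (δ + s) * CX * c) + ((((L ^ k : ℕ) : ℝ)))⁻¹ * ((((L ^ m * L ^ k : ℕ) : ℝ)) * ρ₁) * CY) * c + εA * (((((L ^ k : ℕ) : ℝ)) * ρ * Real.exp (δ + s)) * CX * c) * c + CG₁ * (ωV * CX) * c + εG * ((((d : ℝ) + 1) * (((L ^ k : ℕ) : ℝ)) * ((((L ^ k : ℕ) : ℝ)) * lam)) * CX) * c + CA₁ * (ωN * CX) * c + εA * (((((L ^ k : ℕ) : ℝ)) * ρ) * CX) * c + CG₁ * (ωm * CX) * c + εG * ((((d : ℝ) + 1) * (((((L ^ k : ℕ) : ℝ)) * ρ) * ((((L ^ k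 : ℕ) : ℝ)) * ρ))) * CX) * c + CG₁ * (φQ * CX) * c + εG * ((|a| * (((((L ^ k : ℕ) : ℝ)) ^ (d + 1))⁻¹ * (σ * τ + σ))) * CX) * c) * (1 - (CA₁ * ((((L ^ m * L ^ k : ℕ) : ℝ)) * ρ₁ * Real.exp δ) * c + CG₁ * (((d : ℝ) + 1) * (((L ^ m * L ^ k : ℕ) : ℝ)) * ((((L ^ m * L ^ k : ℕ) : ℝ)) * lam₁)) + CA₁ * ((((L ^ m * L ^ k : ℕ) : ℝ)) * ρ₁) + CG₁ * (((((L ^ m * L ^ k : ℕ) : ℝ)) * ((d + 1 : ℕ) * ρ₁) * Real.exp (δ + s)) * ((((L ^ m * L ^ k : ℕ) : ℝ)) * ρ₁ * Real.exp (δ + s)) * c) * c + |a'| * (((((L ^ m * L ^ k : ℕ) : ℝ)) ^ (d + 1))⁻¹ * CG₁ * (σ₁ * τ₁ + σ₁))) * c)⁻¹ * Real.exp (-((δ - 2 * s) * tdistT M y y'))) := by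
  have hn : (0 : ℝ) < (((L ^ k : ℕ) : ℝ)) ^ (d + 1) := pow_pos (Nat.cast_pos.mpr (Nat.pos_of_ne_zero (NeZero.ne _))) _
  have hn1 : (0 : ℝ) ≤ (((L ^ k : ℕ) : ℝ)) := Nat.cast_nonneg _
  have hn1' : (0 : ℝ) ≤ (((L ^ m * L ^ k : ℕ) : ℝ)) := Nat.cast_nonneg _
  have hninv : (0 : ℝ) ≤ ((((L ^ k : ℕ) : ℝ)))⁻¹ := inv_nonneg.mpr hn1
  have hδ : 0 ≤ δ := by linarith
  have htri := triangle254_unitTorusGeo L k M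
  have hd := unitTorusGeo_dist_nonneg L k M
  have hκS : (BlockNorm.ofBlocks (unitTorusGeo L k M) (liftBlk (blockOf (L ^ k) M) ι)).κ = 1 := kappa_ofBlocks _
  have hκV : (BlockNorm.ofBlocks (unitTorusGeo L k M) (liftBlk (fun b : Tor (fine (L ^ k) M) × Fin (d + 1) => blockOf (L ^ k) M b.1) ι)).κ = 1 := kappa_ofBlocks _
  have hκS1 : (BlockNorm.ofBlocks (unitTorusGeo L k M) (liftBlk (blockOf (L ^ m * L ^ k) M) ι)).κ = 1 := kappa_ofBlocks _
  have hκV1 : (BlockNorm.ofBlocks (unitTorusGeo L k M) (liftBlk (fun b : Tor (fine (L ^ m * L ^ k) M) × Fin (d + 1) => blockOf (L ^ m * L ^ k) M b.1) ι)).κ = 1 := kappa_ofBlocks _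
  have hκU : (BlockNorm.ofBlocks (unitTorusGeo L k M) (liftBlk (fun y : Tor M => y) ι)).κ = 1 := kappa_ofBlocks _
  -- ### the coarse letters of `N = n(1 − T)` (as n15-c∕228)
  have hWr : ∀ μ x i, ∑ j, |(fun ν x => (((L ^ k : ℕ) : ℝ)) • ((1 : Matrix ι ι ℝ) - T ν x)) μ x i j| ≤ (((L ^ k : ℕ) : ℝ)) * ρ := by
    intro μ x i
    have h := hρr μ x i
    calc ∑ j, |(fun ν x => (((L ^ k : ℕ) : ℝ)) • ((1 : Matrix ι ι ℝ) - T ν x)) μ x i j| = (((L ^ k : ℕ) : ℝ)) * ∑ j, |(T μ x - (fun (_ : Fin (d + 1)) (_ : Tor (fine (L ^ k) M)) => (1 : Matrix ι ι ℝ)) μ x) i j| := by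
          rw [Finset.mul_sum]; refine Finset.sum_congr rfl fun j _ => ?_
          simp only [Matrix.smul_apply, smul_eq_mul, abs_mul, abs_of_nonneg hn1, Matrix.sub_apply, Matrix.one_apply]
          rw [abs_sub_comm]
      _ ≤ (((L ^ k : ℕ) : ℝ)) * ρ := mul_le_mul_of_nonneg_left h hn1
  have hWc : ∀ μ x i, ∑ j, |(fun ν x => (((L ^ k : ℕ) : ℝ)) • ((1 : Matrix ι ι ℝ) - T ν x)) μ x j i| ≤ (((L ^ k : ℕ) : ℝ)) * ρ := by
    intro μ x i
    have h := hρc μ x i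
    calc ∑ j, |(fun ν x => (((L ^ k : ℕ) : ℝ)) • ((1 : Matrix ι ι ℝ) - T ν x)) μ x j i| = (((L ^ k : ℕ) : ℝ)) * ∑ j, |(T μ x - (fun (_ : Fin (d + 1)) (_ : Tor (fine (L ^ k) M)) => (1 : Matrix ι ι ℝ)) μ x) j i| := by
          rw [Finset.mul_sum]; refine Finset.sum_congr rfl fun j _ => ?_
          simp only [Matrix.smul_apply, smul_eq_mul, abs_mul, abs_of_nonneg hn1, Matrix.sub_apply, Matrix.one_apply]
          rw [abs_sub_comm]
      _ ≤ (((L ^ k : ℕ) : ℝ)) * ρ := mul_le_mul_of_nonneg_left h hn1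
  have hWlam : ∀ μ (z : Tor (fine (L ^ k) M)) i, ∑ j, |((fun ν x => (((L ^ k : ℕ) : ℝ)) • ((1 : Matrix ι ι ℝ) - T ν x)) μ (z - unitVec (fine (L ^ k) M) μ) - (fun ν x => (((L ^ k : ℕ) : ℝ)) • ((1 : Matrix ι ι ℝ) - T ν x)) μ z) j i| ≤ (((L ^ k : ℕ) : ℝ)) * lam := by
    intro μ z i
    have h := hlamc μ z i
    calc ∑ j, |((fun ν x => (((L ^ k : ℕ) : ℝ)) • ((1 : Matrix ι ι ℝ) - T ν x)) μ (z - unitVec (fine (L ^ k) M) μ) - (fun ν x => (((L ^ k : ℕ) : ℝ)) • ((1 : Matrix ι ι ℝ) - T ν x)) μ z) j i| = (((L ^ k : ℕ) : ℝ)) * ∑ j, |(T μ z - T μ (z - unitVec (fine (L ^ k) M) μ)) j i| := by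
          rw [Finset.mul_sum]; refine Finset.sum_congr rfl fun j _ => ?_
          simp only [Matrix.smul_apply, smul_eq_mul, Matrix.sub_apply]
          rw [← mul_sub, abs_mul, abs_of_nonneg hn1, sub_sub_sub_cancel_left]
      _ ≤ (((L ^ k : ℕ) : ℝ)) * lam := mul_le_mul_of_nonneg_left h hn1
  have hV' : ∀ z i, ∑ j, |(fun z => (bDiv M (L ^ k) (fun ν x => (((L ^ k : ℕ) : ℝ)) • ((1 : Matrix ι ι ℝ) - T ν x)) z)ᵀ) z i j| ≤ ((d : ℝ) + 1) * (((L ^ k : ℕ) : ℝ)) * ((((L ^ k : ℕ) : ℝ)) * lam) := fun z i => cols_bDiv_le M (L ^ k) (fun ν x => (((L ^ k : ℕ) : ℝ)) • ((1 : Matrix ι ι ℝ) - T ν x)) hWlam z i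
  have hmr : ∀ z i, ∑ j, |(fun z => ∑ μ, ((fun ν x => (((L ^ k : ℕ) : ℝ)) • ((1 : Matrix ι ι ℝ) - T ν x)) μ (z - unitVec (fine (L ^ k) M) μ))ᵀ * (fun ν x => (((L ^ k : ℕ) : ℝ)) • ((1 : Matrix ι ι ℝ) - T ν x)) μ (z - unitVec (fine (L ^ k) M) μ)) z i j| ≤ ((d : ℝ) + 1) * (((((L ^ k : ℕ) : ℝ)) * ρ) * ((((L ^ k : ℕ) : ℝ)) * ρ)) := fun z i => rows_mLetter_le M (L ^ k) (fun ν x => (((L ^ k : ℕ) : ℝ)) • ((1 : Matrix ι ι ℝ) - T ν x)) (by positivity) hWr hWc z i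
  -- fine rows of `N′`
  have hWr' : ∀ μ x i, ∑ j, |(fun ν x => (((L ^ m * L ^ k : ℕ) : ℝ)) • ((1 : Matrix ι ι ℝ) - T' ν x)) μ x i j| ≤ (((L ^ m * L ^ k : ℕ) : ℝ)) * ρ₁ := by
    intro μ x i
    have h := hρr' μ x i
    calc ∑ j, |(fun ν x => (((L ^ m * L ^ k : ℕ) : ℝ)) • ((1 : Matrix ι ι ℝ) - T' ν x)) μ x i j| = (((L ^ m * L ^ k : ℕ) : ℝ)) * ∑ j, |(T' μ x - (fun (_ : Fin (d + 1)) (_ : Tor (fine (L ^ m * L ^ k) M)) => (1 : Matrix ι ι ℝ)) μ x) i j| := by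
          rw [Finset.mul_sum]; refine Finset.sum_congr rfl fun j _ => ?_
          simp only [Matrix.smul_apply, smul_eq_mul, abs_mul, abs_of_nonneg hn1', Matrix.sub_apply, Matrix.one_apply]
          rw [abs_sub_comm]
      _ ≤ (((L ^ m * L ^ k : ℕ) : ℝ)) * ρ₁ := mul_le_mul_of_nonneg_left h hn1'
  -- ### coarse one-grid rows of the local operators
  have hBs : HasMaj (BlockNorm.ofBlocks (unitTorusGeo L k M) (liftBlk (blockOf (L ^ k) M) ι)) (BlockNorm.ofBlocks (unitTorusGeo L k M) (liftBlk (fun b : Tor (fine (L ^ k) M) × Fin (d + 1) => blockOf (L ^ k) M b.1) ι)) (Matrix.mulVecLin ((cgrad M (L ^ k) (fun (_ : Fin (d + 1)) (_ : Tor (fine (L ^ k) M)) => (1 : Matrix ι ι ℝ))) - cgrad M (L ^ k) T)) (fun y y' => (((L ^ k : ℕ) : ℝ)) * ρ * Real.exp (δ + s) * Real.exp (-((δ + s) * tdistT M y y'))) := by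
    rw [show ((cgrad M (L ^ k) (fun (_ : Fin (d + 1)) (_ : Tor (fine (L ^ k) M)) => (1 : Matrix ι ι ℝ))) - cgrad M (L ^ k) T) = -(cgrad M (L ^ k) T - (cgrad M (L ^ k) (fun (_ : Fin (d + 1)) (_ : Tor (fine (L ^ k) M)) => (1 : Matrix ι ι ℝ)))) from (neg_sub _ _).symm, mulVecLin_neg']
    exact (hasMaj_cgrad_sub M (L ^ k) L k T hρ0 (by linarith : 0 ≤ δ + s) hρr).neg
  have hS1 : HasMaj (BlockNorm.ofBlocks (unitTorusGeo L k M) (liftBlk (blockOf (L ^ k) M) ι)) (BlockNorm.ofBlocks (unitTorusGeo L k M) (liftBlk (fun b : Tor (fine (L ^ k) M) × Fin (d + 1) => blockOf (L ^ k) M b.1) ι)) (Matrix.mulVecLin (bShift M (L ^ k) (ι := ι))) (fun y y' => 1 * Real.exp (δ + s) * Real.exp (-((δ + s) * tdistT M y y'))) := by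
    rw [bShift_eq_bMulShift_one]
    exact hasMaj_bMulShift M (L ^ k) L k (fun (_ : Fin (d + 1)) (_ : Tor (fine (L ^ k) M)) => (1 : Matrix ι ι ℝ)) zero_le_one (by linarith : 0 ≤ δ + s) (fun ν x i => (rows_one i).le)
  have hSD := hasMaj_sDiag_if M (L ^ k) L k (fun z => (bDiv M (L ^ k) (fun ν x => (((L ^ k : ℕ) : ℝ)) • ((1 : Matrix ι ι ℝ) - T ν x)) z)ᵀ) (by positivity) hV'
  have hCT := hasMaj_bContr_transpose_if M (L ^ k) L k (fun ν x => (((L ^ k : ℕ) : ℝ)) • ((1 : Matrix ι ι ℝ) - T ν x)) (by positivity) hWc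
  have hMM := hasMaj_sDiag_if M (L ^ k) L k (fun z => ∑ μ, ((fun ν x => (((L ^ k : ℕ) : ℝ)) • ((1 : Matrix ι ι ℝ) - T ν x)) μ (z - unitVec (fine (L ^ k) M) μ))ᵀ * (fun ν x => (((L ^ k : ℕ) : ℝ)) • ((1 : Matrix ι ι ℝ) - T ν x)) μ (z - unitVec (fine (L ^ k) M) μ)) (by positivity) hmr
  have hQQt := hasMaj_csavg_sub_transpose M (L ^ k) L k T hσ0 hσc
  have hQQ := hasMaj_csavg_sub M (L ^ k) L k T hσ0 hσr
  have hQ := hasMaj_csavg M (L ^ k) L k T hτ0 hτr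
  have hQ1t := hasMaj_csavg_transpose M (L ^ k) L k (fun (_ : Fin (d + 1)) (_ : Tor (fine (L ^ k) M)) => (1 : Matrix ι ι ℝ)) zero_le_one (stair_one_cols M (L ^ k))
  -- ### the coarse words behind `G′(T)` (constants with the cutting constants `κ = 1` substituted)
  have hSA : HasMaj (BlockNorm.ofBlocks (unitTorusGeo L k M) (liftBlk (blockOf (L ^ k) M) ι)) (BlockNorm.ofBlocks (unitTorusGeo L k M) (liftBlk (fun b : Tor (fine (L ^ k) M) × Fin (d + 1) => blockOf (L ^ k) M b.1) ι)) (Matrix.mulVecLin (bShift M (L ^ k) (ι := ι)) ∘ₗ Matrix.mulVecLin (cGreen M (L ^ k) T a)) (fun y y' => (Real.exp (δ + s) * CX * c) * Real.exp (-(δ * tdistT M y y'))) :=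
    (hasMaj_comp_exp (ρ := δ) htri hd hrow (by positivity) hCX hδ le_rfl (by linarith) hS1 hX).mono fun y y' => le_of_eq (by rw [hκS]; ring)
  have hYA : HasMaj (BlockNorm.ofBlocks (unitTorusGeo L k M) (liftBlk (blockOf (L ^ k) M) ι)) (BlockNorm.ofBlocks (unitTorusGeo L k M) (liftBlk (fun b : Tor (fine (L ^ k) M) × Fin (d + 1) => blockOf (L ^ k) M b.1) ι)) (Matrix.mulVecLin (cgrad M (L ^ k) (fun (_ : Fin (d + 1)) (_ : Tor (fine (L ^ k) M)) => (1 : Matrix ι ι ℝ))) ∘ₗ Matrix.mulVecLin (cGreen M (L ^ k) T a)) (fun y y' => CY * Real.exp (-(δ * tdistT M y y'))) := by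
    rw [← Matrix.mulVecLin_mul]; exact hY
  have hBA : HasMaj (BlockNorm.ofBlocks (unitTorusGeo L k M) (liftBlk (blockOf (L ^ k) M) ι)) (BlockNorm.ofBlocks (unitTorusGeo L k M) (liftBlk (fun b : Tor (fine (L ^ k) M) × Fin (d + 1) => blockOf (L ^ k) M b.1) ι)) (Matrix.mulVecLin ((cgrad M (L ^ k) (fun (_ : Fin (d + 1)) (_ : Tor (fine (L ^ k) M)) => (1 : Matrix ι ι ℝ))) - cgrad M (L ^ k) T) ∘ₗ Matrix.mulVecLin (cGreen M (L ^ k) T a)) (fun y y' => (((((L ^ k : ℕ) : ℝ)) * ρ * Real.exp (δ + s)) * CX * c) * Real.exp (-(δ * tdistT M y y'))) :=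
    (hasMaj_comp_exp (ρ := δ) htri hd hrow (by positivity) hCX hδ le_rfl (by linarith) hBs hX).mono fun y y' => le_of_eq (by rw [hκS]; ring)
  have h𝔰A : HasMaj (BlockNorm.ofBlocks (unitTorusGeo L k M) (liftBlk (blockOf (L ^ k) M) ι)) (BlockNorm.ofBlocks (unitTorusGeo L k M) (liftBlk (blockOf (L ^ k) M) ι)) (Matrix.mulVecLin (sDiag M (L ^ k) (fun z => (bDiv M (L ^ k) (fun ν x => (((L ^ k : ℕ) : ℝ)) • ((1 : Matrix ι ι ℝ) - T ν x)) z)ᵀ)) ∘ₗ Matrix.mulVecLin (cGreen M (L ^ k) T a)) (fun y y' => ((((d : ℝ) + 1) * (((L ^ k : ℕ) : ℝ)) * ((((L ^ k : ℕ) : ℝ)) * lam)) * CX) * Real.exp (-(δ * tdistT M y y'))) :=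
    (hasMaj_comp_localLeft (by positivity) hSD hX).mono fun y y' => le_of_eq (by rw [hκS]; ring)
  have hℭA : HasMaj (BlockNorm.ofBlocks (unitTorusGeo L k M) (liftBlk (blockOf (L ^ k) M) ι)) (BlockNorm.ofBlocks (unitTorusGeo L k M) (liftBlk (fun b : Tor (fine (L ^ k) M) × Fin (d + 1) => blockOf (L ^ k) M b.1) ι)) (Matrix.mulVecLin (bContr M (L ^ k) (fun ν x => (((L ^ k : ℕ) : ℝ)) • ((1 : Matrix ι ι ℝ) - T ν x)))ᵀ ∘ₗ Matrix.mulVecLin (cGreen M (L ^ k) T a)) (fun y y' => (((((L ^ k : ℕ) : ℝ)) * ρ) * CX) * Real.exp (-(δ * tdistT M y y'))) :=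
    (hasMaj_comp_localLeft (by positivity) hCT hX).mono fun y y' => le_of_eq (by rw [hκS]; ring)
  have h𝔪A : HasMaj (BlockNorm.ofBlocks (unitTorusGeo L k M) (liftBlk (blockOf (L ^ k) M) ι)) (BlockNorm.ofBlocks (unitTorusGeo L k M) (liftBlk (blockOf (L ^ k) M) ι)) (Matrix.mulVecLin (sDiag M (L ^ k) (fun z => ∑ μ, ((fun ν x => (((L ^ k : ℕ) : ℝ)) • ((1 : Matrix ι ι ℝ) - T ν x)) μ (z - unitVec (fine (L ^ k) M) μ))ᵀ * (fun ν x => (((L ^ k : ℕ) : ℝ)) • ((1 : Matrix ι ι ℝ) - T ν x)) μ (z - unitVec (fine (L ^ k) M) μ))) ∘ₗ Matrix.mulVecLin (cGreen M (L ^ k) T a)) (fun y y' => ((((d : ℝ) + 1) * (((((L ^ k : ℕ) : ℝ)) * ρ) * ((((L ^ k : ℕ) : ℝ)) * ρ))) * CX) * Real.exp (-(δ * tdistT M y y'))) :=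
    (hasMaj_comp_localLeft (by positivity) hMM hX).mono fun y y' => le_of_eq (by rw [hκS]; ring)
  have hQQ1 : HasMaj (BlockNorm.ofBlocks (unitTorusGeo L k M) (liftBlk (blockOf (L ^ k) M) ι)) (BlockNorm.ofBlocks (unitTorusGeo L k M) (liftBlk (blockOf (L ^ k) M) ι)) (Matrix.mulVecLin (((csavg M (L ^ k) (fun (_ : Fin (d + 1)) (_ : Tor (fine (L ^ k) M)) => (1 : Matrix ι ι ℝ))))ᵀ * (csavg M (L ^ k) (fun (_ : Fin (d + 1)) (_ : Tor (fine (L ^ k) M)) => (1 : Matrix ι ι ℝ))) - ((csavg M (L ^ k) T))ᵀ * (csavg M (L ^ k) T))) (fun y y' => if y = y' then ((((L ^ k : ℕ) : ℝ)) ^ (d + 1))⁻¹ * (σ * τ + σ) else 0) := by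
    have h1 : HasMaj (BlockNorm.ofBlocks (unitTorusGeo L k M) (liftBlk (blockOf (L ^ k) M) ι)) (BlockNorm.ofBlocks (unitTorusGeo L k M) (liftBlk (blockOf (L ^ k) M) ι)) (Matrix.mulVecLin (((csavg M (L ^ k) T) - (csavg M (L ^ k) (fun (_ : Fin (d + 1)) (_ : Tor (fine (L ^ k) M)) => (1 : Matrix ι ι ℝ))))ᵀ * (csavg M (L ^ k) T))) (fun y y' => (if y = y' then ((((L ^ k : ℕ) : ℝ)) ^ (d + 1))⁻¹ * σ else 0) * ((BlockNorm.ofBlocks (unitTorusGeo L k M) (liftBlk (fun y : Tor M => y) ι)).κ * τ)) := by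
      rw [Matrix.mulVecLin_mul]; exact hasMaj_comp_localRight hQQt hQ fun y y' => by positivity
    have h2 : HasMaj (BlockNorm.ofBlocks (unitTorusGeo L k M) (liftBlk (blockOf (L ^ k) M) ι)) (BlockNorm.ofBlocks (unitTorusGeo L k M) (liftBlk (blockOf (L ^ k) M) ι)) (Matrix.mulVecLin (((csavg M (L ^ k) (fun (_ : Fin (d + 1)) (_ : Tor (fine (L ^ k) M)) => (1 : Matrix ι ι ℝ))))ᵀ * ((csavg M (L ^ k) T) - (csavg M (L ^ k) (fun (_ : Fin (d + 1)) (_ : Tor (fine (L ^ k) M)) => (1 : Matrix ι ι ℝ)))))) (fun y y' => (if y = y' then ((((L ^ k : ℕ) : ℝ)) ^ (d + 1))⁻¹ * 1 else 0) * ((BlockNorm.ofBlocks (unitTorusGeo L k M) (liftBlk (fun y : Tor M => y) ι)).κ * σ)) := by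
      rw [Matrix.mulVecLin_mul]; exact hasMaj_comp_localRight hQ1t hQQ fun y y' => by positivity
    have hQ' : (((csavg M (L ^ k) (fun (_ : Fin (d + 1)) (_ : Tor (fine (L ^ k) M)) => (1 : Matrix ι ι ℝ))))ᵀ * (csavg M (L ^ k) (fun (_ : Fin (d + 1)) (_ : Tor (fine (L ^ k) M)) => (1 : Matrix ι ι ℝ))) - ((csavg M (L ^ k) T))ᵀ * (csavg M (L ^ k) T)) = -((((csavg M (L ^ k) T) - (csavg M (L ^ k) (fun (_ : Fin (d + 1)) (_ : Tor (fine (L ^ k) M)) => (1 : Matrix ι ι ℝ))))ᵀ * (csavg M (L ^ k) T)) + (((csavg M (L ^ k) (fun (_ : Fin (d + 1)) (_ : Tor (fine (L ^ k) M)) => (1 : Matrix ι ι ℝ))))ᵀ * ((csavg M (L ^ k) T) - (csavg M (L ^ k) (fun (_ : Fin (d + 1)) (_ : Tor (fine (L ^ k) M)) => (1 : Matrix ι ι ℝ)))))) := by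
      rw [Matrix.transpose_sub, Matrix.sub_mul, Matrix.mul_sub]; abel
    rw [hQ', mulVecLin_neg', Matrix.mulVecLin_add]
    refine ((h1.add h2).neg).mono fun y y' => le_of_eq ?_
    rw [hκU]; split_ifs <;> ring
  have hQA : HasMaj (BlockNorm.ofBlocks (unitTorusGeo L k M) (liftBlk (blockOf (L ^ k) M) ι)) (BlockNorm.ofBlocks (unitTorusGeo L k M) (liftBlk (blockOf (L ^ k) M) ι)) (Matrix.mulVecLin (a • (((csavg M (L ^ k) (fun (_ : Fin (d + 1)) (_ : Tor (fine (L ^ k) M)) => (1 : Matrix ι ι ℝ))))ᵀ * (csavg M (L ^ k) (fun (_ : Fin (d + 1)) (_ : Tor (fine (L ^ k) M)) => (1 : Matrix ι ι ℝ))) - ((csavg M (L ^ k) T))ᵀ * (csavg M (L ^ k) T))) ∘ₗ Matrix.mulVecLin (cGreen M (L ^ k) T a)) (fun y y' => ((|a| * (((((L ^ k : ℕ) : ℝ)) ^ (d + 1))⁻¹ * (σ * τ + σ))) * CX) * Real.exp (-(δ * tdistT M y y'))) := by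
    have h := hasMaj_smul_ofBlocks (g := unitTorusGeo L k M) (liftBlk (blockOf (L ^ k) M) ι) (K := fun y y' => if y = y' then ((((L ^ k : ℕ) : ℝ)) ^ (d + 1))⁻¹ * (σ * τ + σ) else 0) (fun y y' => by positivity) a hQQ1
    rw [← mulVecLin_smul'] at h
    have h' : HasMaj (BlockNorm.ofBlocks (unitTorusGeo L k M) (liftBlk (blockOf (L ^ k) M) ι)) (BlockNorm.ofBlocks (unitTorusGeo L k M) (liftBlk (blockOf (L ^ k) M) ι)) (Matrix.mulVecLin (a • (((csavg M (L ^ k) (fun (_ : Fin (d + 1)) (_ : Tor (fine (L ^ k) M)) => (1 : Matrix ι ι ℝ))))ᵀ * (csavg M (L ^ k) (fun (_ : Fin (d + 1)) (_ : Tor (fine (L ^ k) M)) => (1 : Matrix ι ι ℝ))) - ((csavg M (L ^ k) T))ᵀ * (csavg M (L ^ k) T)))) (fun y y' => if y = y' then |a| * (((((L ^ k : ℕ) : ℝ)) ^ (d + 1))⁻¹ * (σ * τ + σ)) else 0) :=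
      h.mono fun y y' => le_of_eq (by split_ifs <;> simp)
    exact (hasMaj_comp_localLeft (by positivity) h' hX).mono fun y y' => le_of_eq (by rw [hκS]; ring)
  -- ### the two-grid pieces of the local letters on `G′(T)` (n15-c∕235)
  have hDB : HasMaj (BlockNorm.ofBlocks (unitTorusGeo L k M) (liftBlk (blockOf (L ^ k) M) ι)) (BlockNorm.ofBlocks (unitTorusGeo L k M) (liftBlk (fun b : Tor (fine (L ^ m * L ^ k) M) × Fin (d + 1) => blockOf (L ^ m * L ^ k) M b.1) ι)) (idef (pull (liftMap (kingPr L k m M) ι)) (pull (liftMap (kingPrV L k m M) ι)) (Matrix.mulVecLin ((cgrad M (L ^ m * L ^ k) (fun (_ : Fin (d + 1)) (_ : Tor (fine (L ^ m * L ^ k) M)) => (1 : Matrix ι ι ℝ))) - cgrad M (L ^ m * L ^ k) T')) (Matrix.mulVecLin ((cgrad M (L ^ k) (fun (_ : Fin (d + 1)) (_ : Tor (fine (L ^ k) M)) => (1 : Matrix ι ι ℝ))) - cgrad M (L ^ k) T)) ∘ₗ Matrix.mulVecLin (cGreen M (L ^ k) T a))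
      (fun y y' => (ωN * (Real.exp (δ + s) * CX * c) + ((((L ^ k : ℕ) : ℝ)))⁻¹ * ((((L ^ m * L ^ k : ℕ) : ℝ)) * ρ₁) * CY) * Real.exp (-(δ * tdistT M y y'))) := by
    rw [cgrad_one_sub_eq_bMulShift, cgrad_one_sub_eq_bMulShift]
    exact (hasMaj_idef_bMulShift_comp M L k m (fun ν x => (((L ^ m * L ^ k : ℕ) : ℝ)) • ((1 : Matrix ι ι ℝ) - T' ν x)) (fun ν x => (((L ^ k : ℕ) : ℝ)) • ((1 : Matrix ι ι ℝ) - T ν x)) hωN0 (by positivity) (fun y y' => by positivity) hωNr hWr' hSA hYA).mono fun y y' => le_of_eq (by ring)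
  have hD𝔰 : HasMaj (BlockNorm.ofBlocks (unitTorusGeo L k M) (liftBlk (blockOf (L ^ k) M) ι)) (BlockNorm.ofBlocks (unitTorusGeo L k M) (liftBlk (blockOf (L ^ m * L ^ k) M) ι)) (idef (pull (liftMap (kingPr L k m M) ι)) (pull (liftMap (kingPr L k m M) ι)) (Matrix.mulVecLin (sDiag M (L ^ m * L ^ k) (fun z => (bDiv M (L ^ m * L ^ k) (fun ν x => (((L ^ m * L ^ k : ℕ) : ℝ)) • ((1 : Matrix ι ι ℝ) - T' ν x)) z)ᵀ))) (Matrix.mulVecLin (sDiag M (L ^ k) (fun z => (bDiv M (L ^ k) (fun ν x => (((L ^ k : ℕ) : ℝ)) • ((1 : Matrix ι ι ℝ) - T ν x)) z)ᵀ))) ∘ₗ Matrix.mulVecLin (cGreen M (L ^ k) T a)) (fun y y' => (ωV * CX) * Real.exp (-(δ * tdistT M y y'))) := by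
    rw [idef_sDiag]
    exact (hasMaj_comp_localLeft hωV0 (hasMaj_sDiag_pull M L k m _ hωV0 hωV) hX).mono fun y y' => le_of_eq (by rw [hκS]; ring)
  have hDℭ : HasMaj (BlockNorm.ofBlocks (unitTorusGeo L k M) (liftBlk (blockOf (L ^ k) M) ι)) (BlockNorm.ofBlocks (unitTorusGeo L k M) (liftBlk (fun b : Tor (fine (L ^ m * L ^ k) M) × Fin (d + 1) => blockOf (L ^ m * L ^ k) M b.1) ι)) (idef (pull (liftMap (kingPr L k m M) ι)) (pull (liftMap (kingPrV L k m M) ι)) (Matrix.mulVecLin (bContr M (L ^ m * L ^ k) (fun ν x => (((L ^ m * L ^ k : ℕ) : ℝ)) • ((1 : Matrix ι ι ℝ) - T' ν x)))ᵀ) (Matrix.mulVecLin (bContr M (L ^ k) (fun ν x => (((L ^ k : ℕ) : ℝ)) • ((1 : Matrix ι ι ℝ) - T ν x)))ᵀ) ∘ₗ Matrix.mulVecLin (cGreen M (L ^ k) T a)) (fun y y' => (ωN * CX) * Real.exp (-(δ * tdistT M y y'))) := by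
    rw [idef_bContr_transpose]
    exact (hasMaj_comp_localLeft hωN0 (hasMaj_bContr_transpose_pull M L k m _ hωN0 hωNc) hX).mono fun y y' => le_of_eq (by rw [hκS]; ring)
  have hD𝔪 : HasMaj (BlockNorm.ofBlocks (unitTorusGeo L k M) (liftBlk (blockOf (L ^ k) M) ι)) (BlockNorm.ofBlocks (unitTorusGeo L k M) (liftBlk (blockOf (L ^ m * L ^ k) M) ι)) (idef (pull (liftMap (kingPr L k m M) ι)) (pull (liftMap (kingPr L k m M) ι)) (Matrix.mulVecLin (sDiag M (L ^ m * L ^ k) (fun z => ∑ μ, ((fun ν x => (((L ^ m * L ^ k : ℕ) : ℝ)) • ((1 : Matrix ι ι ℝ) - T' ν x)) μ (z - unitVec (fine (L ^ m * L ^ k) M) μ))ᵀ * (fun ν x => (((L ^ m * L ^ k : ℕ) : ℝ)) • ((1 : Matrix ι ι ℝ) - T' ν x)) μ (z - unitVec (fine (L ^ m * L ^ k) M) μ)))) (Matrix.mulVecLin (sDiag M (L ^ k) (fun z => ∑ μ, ((fun ν x => (((L ^ k : ℕ) : ℝ)) • ((1 : Matrix ι ι ℝ) - T ν x)) μ (z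 - unitVec (fine (L ^ k) M) μ))ᵀ * (fun ν x => (((L ^ k : ℕ) : ℝ)) • ((1 : Matrix ι ι ℝ) - T ν x)) μ (z - unitVec (fine (L ^ k) M) μ)))) ∘ₗ Matrix.mulVecLin (cGreen M (L ^ k) T a)) (fun y y' => (ωm * CX) * Real.exp (-(δ * tdistT M y y'))) := by
    rw [idef_sDiag]
    exact (hasMaj_comp_localLeft hωm0 (hasMaj_sDiag_pull M L k m _ hωm0 hωm) hX).mono fun y y' => le_of_eq (by rw [hκS]; ring)
  have hDQA : HasMaj (BlockNorm.ofBlocks (unitTorusGeo L k M) (liftBlk (blockOf (L ^ k) M) ι)) (BlockNorm.ofBlocks (unitTorusGeo L k M) (liftBlk (blockOf (L ^ m * L ^ k) M) ι)) (idef (pull (liftMap (kingPr L k m M) ι)) (pull (liftMap (kingPr L k m M) ι)) (Matrix.mulVecLin (a' • (((csavg M (L ^ m * L ^ k) (fun (_ : Fin (d + 1)) (_ : Tor (fine (L ^ m * L ^ k) M)) => (1 : Matrix ι ι ℝ))))ᵀ * (csavg M (L ^ m * L ^ k) (fun (_ : Fin (d + 1)) (_ : Tor (fine (L ^ m * L ^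 k) M)) => (1 : Matrix ι ι ℝ))) - ((csavg M (L ^ m * L ^ k) T'))ᵀ * (csavg M (L ^ m * L ^ k) T')))) (Matrix.mulVecLin (a • (((csavg M (L ^ k) (fun (_ : Fin (d + 1)) (_ : Tor (fine (L ^ k) M)) => (1 : Matrix ι ι ℝ))))ᵀ * (csavg M (L ^ k) (fun (_ : Fin (d + 1)) (_ : Tor (fine (L ^ k) M)) => (1 : Matrix ι ι ℝ))) - ((csavg M (L ^ k) T))ᵀ * (csavg M (L ^ k) T)))) ∘ₗ Matrix.mulVecLin (cGreen M (L ^ k) T a)) (fun y y' => (φQ * CX) * Real.exp (-(δ * tdistT M y y'))) :=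
    (hasMaj_comp_localLeft hφQ0 hDQ hX).mono fun y y' => le_of_eq (by rw [hκS]; ring)
  -- ### the ten words of `𝔇(K′, K)·G′(T)` (rate `δ − s`, lowered to `δ − 2s`)
  have w1a := hasMaj_comp_exp (ρ := δ - s) htri hd hrow hCA₁ (by positivity) (by linarith) (by linarith) (by linarith) hA1' hDB
  have w1b := hasMaj_comp_exp (ρ := δ - s) htri hd hrow hεA (by positivity) (by linarith) (by linarith) (by linarith) hDA hBA
  have w2a := hasMaj_comp_exp (ρ := δ - s) htri hd hrow hCG₁ (by positivity) (by linarith) (by linarith) (by linarith) hG1' hD𝔰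
  have w2b := hasMaj_comp_exp (ρ := δ - s) htri hd hrow hεG (by positivity) (by linarith) (by linarith) (by linarith) hDG h𝔰A
  have w2c := hasMaj_comp_exp (ρ := δ - s) htri hd hrow hCA₁ (by positivity) (by linarith) (by linarith) (by linarith) hA1' hDℭ
  have w2d := hasMaj_comp_exp (ρ := δ - s) htri hd hrow hεA (by positivity) (by linarith) (by linarith) (by linarith) hDA hℭA
  have w3a := hasMaj_comp_exp (ρ := δ - s) htri hd hrow hCG₁ (by positivity) (by linarith) (by linarith) (by linarith) hG1' hD𝔪
  have w3b := hasMaj_comp_exp (ρ := δ - s) htri hd hrow hεG (by positivity) (by linarith) (by linarith) (by linarith) hDG h𝔪A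
  have w4a := hasMaj_comp_exp (ρ := δ - s) htri hd hrow hCG₁ (by positivity) (by linarith) (by linarith) (by linarith) hG1' hDQA
  have w4b := hasMaj_comp_exp (ρ := δ - s) htri hd hrow hεG (by positivity) (by linarith) (by linarith) (by linarith) hDG hQA
  simp only [hκS, hκV, hκS1, hκV1] at w1a w1b w2a w2b w2c w2d w3a w3b w4a w4b
  replace w1a := w1a.of_rate_le hd (by positivity) (by linarith : δ - 2 * s ≤ δ - s)
  replace w1b := w1b.of_rate_le hd (by positivity) (by linarith : δ - 2 * s ≤ δ - s)
  replace w2a := w2a.of_rate_le hd (by positivity) (by linarith : δ - 2 * s ≤ δ - s)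
  replace w2b := w2b.of_rate_le hd (by positivity) (by linarith : δ - 2 * s ≤ δ - s)
  replace w2c := w2c.of_rate_le hd (by positivity) (by linarith : δ - 2 * s ≤ δ - s)
  replace w2d := w2d.of_rate_le hd (by positivity) (by linarith : δ - 2 * s ≤ δ - s)
  replace w3a := w3a.of_rate_le hd (by positivity) (by linarith : δ - 2 * s ≤ δ - s)
  replace w3b := w3b.of_rate_le hd (by positivity) (by linarith : δ - 2 * s ≤ δ - s)
  replace w4a := w4a.of_rate_le hd (by positivity) (by linarith : δ - 2 * s ≤ δ - s)
  replace w4b := w4b.of_rate_le hd (by positivity) (by linarith : δ - 2 * s ≤ δ - s)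
  -- ### the step on both grids in the normal form (kernel) ∘ (local)
  have hTL : Matrix.mulVecLin (((cgrad M (L ^ k) (fun (_ : Fin (d + 1)) (_ : Tor (fine (L ^ k) M)) => (1 : Matrix ι ι ℝ))) - cgrad M (L ^ k) T))ᵀ ∘ₗ Matrix.mulVecLin (cgrad M (L ^ k) (fun (_ : Fin (d + 1)) (_ : Tor (fine (L ^ k) M)) => (1 : Matrix ι ι ℝ))) = Matrix.mulVecLin (sDiag M (L ^ k) (fun z => (bDiv M (L ^ k) (fun ν x => (((L ^ k : ℕ) : ℝ)) • ((1 : Matrix ι ι ℝ) - T ν x)) z)ᵀ)) - Matrix.mulVecLin ((cgrad M (L ^ k) (fun (_ : Fin (d + 1)) (_ : Tor (fine (L ^ k) M)) => (1 : Matrix ι ι ℝ))))ᵀ ∘ₗ Matrix.mulVecLin (bContr M (L ^ k) (fun ν x => (((L ^ k : ℕ) : ℝ)) • ((1 : Matrix ι ι ℝ) - T ν x)))ᵀ := by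
    refine LinearMap.ext fun f => ?_
    simp only [LinearMap.comp_apply, LinearMap.sub_apply, Matrix.mulVecLin_apply, cgrad_one_sub_eq_bMulShift]
    exact bMulShift_transpose_mulVec_cgrad_one M (L ^ k) (fun ν x => (((L ^ k : ℕ) : ℝ)) • ((1 : Matrix ι ι ℝ) - T ν x)) f
  have hTL' : Matrix.mulVecLin (((cgrad M (L ^ m * L ^ k) (fun (_ : Fin (d + 1)) (_ : Tor (fine (L ^ m * L ^ k) M)) => (1 : Matrix ι ι ℝ))) - cgrad M (L ^ m * L ^ k) T'))ᵀ ∘ₗ Matrix.mulVecLin (cgrad M (L ^ m * L ^ k) (fun (_ : Fin (d + 1)) (_ : Tor (fine (L ^ m * L ^ k) M)) => (1 : Matrix ι ι ℝ))) = Matrix.mulVecLin (sDiag M (L ^ m * L ^ k) (fun z => (bDiv M (L ^ m * L ^ k) (fun ν x => (((L ^ m * L ^ k : ℕ) : ℝ)) • ((1 : Matrix ι ι ℝ) - T' ν x)) z)ᵀ)) - Matrix.mulVecLin ((cgrad M (L ^ m * L ^ k) (fun (_ : Fin (d + 1)) (_ : Tor (fine (L ^ m * L ^ k) M)) => (1 :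 Matrix ι ι ℝ))))ᵀ ∘ₗ Matrix.mulVecLin (bContr M (L ^ m * L ^ k) (fun ν x => (((L ^ m * L ^ k : ℕ) : ℝ)) • ((1 : Matrix ι ι ℝ) - T' ν x)))ᵀ := by
    refine LinearMap.ext fun f => ?_
    simp only [LinearMap.comp_apply, LinearMap.sub_apply, Matrix.mulVecLin_apply, cgrad_one_sub_eq_bMulShift]
    exact bMulShift_transpose_mulVec_cgrad_one M (L ^ m * L ^ k) (fun ν x => (((L ^ m * L ^ k : ℕ) : ℝ)) • ((1 : Matrix ι ι ℝ) - T' ν x)) f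
  have hBB : (((cgrad M (L ^ k) (fun (_ : Fin (d + 1)) (_ : Tor (fine (L ^ k) M)) => (1 : Matrix ι ι ℝ))) - cgrad M (L ^ k) T))ᵀ * ((cgrad M (L ^ k) (fun (_ : Fin (d + 1)) (_ : Tor (fine (L ^ k) M)) => (1 : Matrix ι ι ℝ))) - cgrad M (L ^ k) T) = sDiag M (L ^ k) (fun z => ∑ μ, ((fun ν x => (((L ^ k : ℕ) : ℝ)) • ((1 : Matrix ι ι ℝ) - T ν x)) μ (z - unitVec (fine (L ^ k) M) μ))ᵀ * (fun ν x => (((L ^ k : ℕ) : ℝ)) • ((1 : Matrix ι ι ℝ) - T ν x)) μ (z - unitVec (fine (L ^ k) M) μ)) := by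
    rw [cgrad_one_sub_eq_bMulShift]; exact bMulShift_transpose_mul_bMulShift M (L ^ k) (fun ν x => (((L ^ k : ℕ) : ℝ)) • ((1 : Matrix ι ι ℝ) - T ν x))
  have hBB' : (((cgrad M (L ^ m * L ^ k) (fun (_ : Fin (d + 1)) (_ : Tor (fine (L ^ m * L ^ k) M)) => (1 : Matrix ι ι ℝ))) - cgrad M (L ^ m * L ^ k) T'))ᵀ * ((cgrad M (L ^ m * L ^ k) (fun (_ : Fin (d + 1)) (_ : Tor (fine (L ^ m * L ^ k) M)) => (1 : Matrix ι ι ℝ))) - cgrad M (L ^ m * L ^ k) T') = sDiag M (L ^ m * L ^ k) (fun z => ∑ μ, ((fun ν x => (((L ^ m * L ^ k : ℕ) : ℝ)) • ((1 : Matrix ι ι ℝ) - T' ν x)) μ (z - unitVec (fine (L ^ m * L ^ k) M) μ))ᵀ * (fun ν x => (((L ^ m * L ^ k : ℕ) : ℝ)) • ((1 : Matrix ι ι ℝ) - T' ν x)) μ (z - unitVec (fine (L ^ m * L ^ k) M) μ)) := by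
    rw [cgrad_one_sub_eq_bMulShift]; exact bMulShift_transpose_mul_bMulShift M (L ^ m * L ^ k) (fun ν x => (((L ^ m * L ^ k : ℕ) : ℝ)) • ((1 : Matrix ι ι ℝ) - T' ν x))
  have hKn : Matrix.mulVecLin ((cGreen M (L ^ k) (fun (_ : Fin (d + 1)) (_ : Tor (fine (L ^ k) M)) => (1 : Matrix ι ι ℝ)) a) * (claplA M (L ^ k) (fun (_ : Fin (d + 1)) (_ : Tor (fine (L ^ k) M)) => (1 : Matrix ι ι ℝ)) a - claplA M (L ^ k) T a)) = Matrix.mulVecLin ((cGreen M (L ^ k) (fun (_ : Fin (d + 1)) (_ : Tor (fine (L ^ k) M)) => (1 : Matrix ι ι ℝ)) a) * ((cgrad M (L ^ k) (fun (_ : Fin (d + 1)) (_ : Tor (fine (L ^ k) M)) => (1 : Matrix ι ι ℝ))))ᵀ) ∘ₗ Matrix.mulVecLin ((cgrad M (L ^ k) (fun (_ : Fin (d + 1)) (_ : Tor (fine (L ^ k) M)) => (1 : Matrix ι ι ℝ))) - cgrad M (L ^ k) T)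
      + (Matrix.mulVecLin (cGreen M (L ^ k) (fun (_ : Fin (d + 1)) (_ : Tor (fine (L ^ k) M)) => (1 : Matrix ι ι ℝ)) a) ∘ₗ Matrix.mulVecLin (sDiag M (L ^ k) (fun z => (bDiv M (L ^ k) (fun ν x => (((L ^ k : ℕ) : ℝ)) • ((1 : Matrix ι ι ℝ) - T ν x)) z)ᵀ)) - Matrix.mulVecLin ((cGreen M (L ^ k) (fun (_ : Fin (d + 1)) (_ : Tor (fine (L ^ k) M)) => (1 : Matrix ι ι ℝ)) a) * ((cgrad M (L ^ k) (fun (_ : Fin (d + 1)) (_ : Tor (fine (L ^ k) M)) => (1 : Matrix ι ι ℝ))))ᵀ) ∘ₗ Matrix.mulVecLin (bContr M (L ^ k) (fun ν x => (((L ^ k : ℕ) : ℝ)) • ((1 : Matrix ι ι ℝ) - T ν x)))ᵀ)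
      - Matrix.mulVecLin (cGreen M (L ^ k) (fun (_ : Fin (d + 1)) (_ : Tor (fine (L ^ k) M)) => (1 : Matrix ι ι ℝ)) a) ∘ₗ Matrix.mulVecLin (sDiag M (L ^ k) (fun z => ∑ μ, ((fun ν x => (((L ^ k : ℕ) : ℝ)) • ((1 : Matrix ι ι ℝ) - T ν x)) μ (z - unitVec (fine (L ^ k) M) μ))ᵀ * (fun ν x => (((L ^ k : ℕ) : ℝ)) • ((1 : Matrix ι ι ℝ) - T ν x)) μ (z - unitVec (fine (L ^ k) M) μ))) + Matrix.mulVecLin (cGreen M (L ^ k) (fun (_ : Fin (d + 1)) (_ : Tor (fine (L ^ k) M)) => (1 : Matrix ι ι ℝ)) a) ∘ₗ Matrix.mulVecLin (a • (((csavg M (L ^ k) (fun (_ : Fin (d + 1)) (_ : Tor (fine (L ^ k) M)) => (1 : Matrix ι ι ℝ))))ᵀ * (csavg M (L ^ k) (fun (_ : Fin (d + 1)) (_ : Tor (fine (L ^ k) M)) => (1 : Matrix ι ι ℝ))) - ((csavg M (L ^ k) T))ᵀ * (csavg M (L ^ k) T))) := by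
    rw [cGreen_one_mul_claplA_sub_eq, Matrix.mulVecLin_add, mulVecLin_sub', Matrix.mulVecLin_add, hBB, ← Matrix.mul_smul, Matrix.mulVecLin_mul ((cGreen M (L ^ k) (fun (_ : Fin (d + 1)) (_ : Tor (fine (L ^ k) M)) => (1 : Matrix ι ι ℝ)) a) * ((cgrad M (L ^ k) (fun (_ : Fin (d + 1)) (_ : Tor (fine (L ^ k) M)) => (1 : Matrix ι ι ℝ))))ᵀ) ((cgrad M (L ^ k) (fun (_ : Fin (d + 1)) (_ : Tor (fine (L ^ k) M)) => (1 : Matrix ι ι ℝ))) - cgrad M (L ^ k) T),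
      Matrix.mulVecLin_mul (cGreen M (L ^ k) (fun (_ : Fin (d + 1)) (_ : Tor (fine (L ^ k) M)) => (1 : Matrix ι ι ℝ)) a) ((((cgrad M (L ^ k) (fun (_ : Fin (d + 1)) (_ : Tor (fine (L ^ k) M)) => (1 : Matrix ι ι ℝ))) - cgrad M (L ^ k) T))ᵀ * (cgrad M (L ^ k) (fun (_ : Fin (d + 1)) (_ : Tor (fine (L ^ k) M)) => (1 : Matrix ι ι ℝ)))), Matrix.mulVecLin_mul (((cgrad M (L ^ k) (fun (_ : Fin (d + 1)) (_ : Tor (fine (L ^ k) M)) => (1 : Matrix ι ι ℝ))) - cgrad M (L ^ k) T))ᵀ (cgrad M (L ^ k) (fun (_ : Fin (d + 1)) (_ : Tor (fine (L ^ k) M)) => (1 : Matrix ι ι ℝ))), Matrix.mulVecLin_mul (cGreen M (L ^ k) (fun (_ : Fin (d + 1)) (_ : Tor (fine (L ^ k) M)) => (1 : Matrix ι ι ℝ)) a) (sDiag M (L ^ k) (fun z => ∑ μ, ((fun ν x => (((L ^ k : ℕ) : ℝ)) • ((1 : Matrix ι ι ℝ) - T ν x)) μ (z - unitVec (fine (L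 ^ k) M) μ))ᵀ * (fun ν x => (((L ^ k : ℕ) : ℝ)) • ((1 : Matrix ι ι ℝ) - T ν x)) μ (z - unitVec (fine (L ^ k) M) μ))), Matrix.mulVecLin_mul (cGreen M (L ^ k) (fun (_ : Fin (d + 1)) (_ : Tor (fine (L ^ k) M)) => (1 : Matrix ι ι ℝ)) a) (a • (((csavg M (L ^ k) (fun (_ : Fin (d + 1)) (_ : Tor (fine (L ^ k) M)) => (1 : Matrix ι ι ℝ))))ᵀ * (csavg M (L ^ k) (fun (_ : Fin (d + 1)) (_ : Tor (fine (L ^ k) M)) => (1 : Matrix ι ι ℝ))) - ((csavg M (L ^ k) T))ᵀ * (csavg M (L ^ k) T))), hTL, LinearMap.comp_sub,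
      ← LinearMap.comp_assoc, ← Matrix.mulVecLin_mul (cGreen M (L ^ k) (fun (_ : Fin (d + 1)) (_ : Tor (fine (L ^ k) M)) => (1 : Matrix ι ι ℝ)) a) ((cgrad M (L ^ k) (fun (_ : Fin (d + 1)) (_ : Tor (fine (L ^ k) M)) => (1 : Matrix ι ι ℝ))))ᵀ]
  have hKn' : Matrix.mulVecLin ((cGreen M (L ^ m * L ^ k) (fun (_ : Fin (d + 1)) (_ : Tor (fine (L ^ m * L ^ k) M)) => (1 : Matrix ι ι ℝ)) a') * (claplA M (L ^ m * L ^ k) (fun (_ : Fin (d + 1)) (_ : Tor (fine (L ^ m * L ^ k) M)) => (1 : Matrix ι ι ℝ)) a' - claplA M (L ^ m * L ^ k) T' a')) = Matrix.mulVecLin ((cGreen M (L ^ m * L ^ k) (fun (_ : Fin (d + 1)) (_ : Tor (fine (L ^ m * L ^ k) M)) => (1 : Matrix ι ι ℝ)) a') * ((cgrad M (L ^ m * L ^ k) (fun (_ : Fin (d + 1)) (_ : Tor (fine (L ^ m * L ^ k) M)) => (1 : Matrix ι ι ℝ))))ᵀ) ∘ₗ Matrix.mulVecLin ((cgrad M (L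 ^ m * L ^ k) (fun (_ : Fin (d + 1)) (_ : Tor (fine (L ^ m * L ^ k) M)) => (1 : Matrix ι ι ℝ))) - cgrad M (L ^ m * L ^ k) T')
      + (Matrix.mulVecLin (cGreen M (L ^ m * L ^ k) (fun (_ : Fin (d + 1)) (_ : Tor (fine (L ^ m * L ^ k) M)) => (1 : Matrix ι ι ℝ)) a') ∘ₗ Matrix.mulVecLin (sDiag M (L ^ m * L ^ k) (fun z => (bDiv M (L ^ m * L ^ k) (fun ν x => (((L ^ m * L ^ k : ℕ) : ℝ)) • ((1 : Matrix ι ι ℝ) - T' ν x)) z)ᵀ)) - Matrix.mulVecLin ((cGreen M (L ^ m * L ^ k) (fun (_ : Fin (d + 1)) (_ : Tor (fine (L ^ m * L ^ k) M)) => (1 : Matrix ι ι ℝ)) a') * ((cgrad M (L ^ m * L ^ k) (fun (_ : Fin (d + 1)) (_ : Tor (fine (L ^ m * L ^ k) M)) => (1 : Matrix ι ι ℝ))))ᵀ) ∘ₗ Matrix.mulVecLin (bContr M (L ^ m * L ^ k) (fun ν x => (((L ^ m * L ^ k : ℕ) : ℝ)) • ((1 : Matrix ι ι ℝ) - T' ν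 x)))ᵀ)
      - Matrix.mulVecLin (cGreen M (L ^ m * L ^ k) (fun (_ : Fin (d + 1)) (_ : Tor (fine (L ^ m * L ^ k) M)) => (1 : Matrix ι ι ℝ)) a') ∘ₗ Matrix.mulVecLin (sDiag M (L ^ m * L ^ k) (fun z => ∑ μ, ((fun ν x => (((L ^ m * L ^ k : ℕ) : ℝ)) • ((1 : Matrix ι ι ℝ) - T' ν x)) μ (z - unitVec (fine (L ^ m * L ^ k) M) μ))ᵀ * (fun ν x => (((L ^ m * L ^ k : ℕ) : ℝ)) • ((1 : Matrix ι ι ℝ) - T' ν x)) μ (z - unitVec (fine (L ^ m * L ^ k) M) μ))) + Matrix.mulVecLin (cGreen M (L ^ m * L ^ k) (fun (_ : Fin (d + 1)) (_ : Tor (fine (L ^ m * L ^ k) M)) => (1 : Matrix ι ι ℝ)) a') ∘ₗ Matrix.mulVecLin (a' • (((csavg M (L ^ m * L ^ k) (fun (_ : Fin (d + 1)) (_ : Tor (fine (L ^ m * L ^ k) M)) => (1 : Matrix ι ι ℝ))))ᵀ * (csavg M (L ^ m * L ^ k) (fun (_ : Fin (d + 1)) (_ : Tor (fine (L ^ m *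 L ^ k) M)) => (1 : Matrix ι ι ℝ))) - ((csavg M (L ^ m * L ^ k) T'))ᵀ * (csavg M (L ^ m * L ^ k) T'))) := by
    rw [cGreen_one_mul_claplA_sub_eq, Matrix.mulVecLin_add, mulVecLin_sub', Matrix.mulVecLin_add, hBB', ← Matrix.mul_smul, Matrix.mulVecLin_mul ((cGreen M (L ^ m * L ^ k) (fun (_ : Fin (d + 1)) (_ : Tor (fine (L ^ m * L ^ k) M)) => (1 : Matrix ι ι ℝ)) a') * ((cgrad M (L ^ m * L ^ k) (fun (_ : Fin (d + 1)) (_ : Tor (fine (L ^ m * L ^ k) M)) => (1 : Matrix ι ι ℝ))))ᵀ) ((cgrad M (L ^ m * L ^ k) (fun (_ : Fin (d + 1)) (_ : Tor (fine (L ^ m * L ^ k) M)) => (1 : Matrix ι ι ℝ))) - cgrad M (L ^ m * L ^ k) T'),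
      Matrix.mulVecLin_mul (cGreen M (L ^ m * L ^ k) (fun (_ : Fin (d + 1)) (_ : Tor (fine (L ^ m * L ^ k) M)) => (1 : Matrix ι ι ℝ)) a') ((((cgrad M (L ^ m * L ^ k) (fun (_ : Fin (d + 1)) (_ : Tor (fine (L ^ m * L ^ k) M)) => (1 : Matrix ι ι ℝ))) - cgrad M (L ^ m * L ^ k) T'))ᵀ * (cgrad M (L ^ m * L ^ k) (fun (_ : Fin (d + 1)) (_ : Tor (fine (L ^ m * L ^ k) M)) => (1 : Matrix ι ι ℝ)))), Matrix.mulVecLin_mul (((cgrad M (L ^ m * L ^ k) (fun (_ : Fin (d + 1)) (_ : Tor (fine (L ^ m * L ^ k) M)) => (1 : Matrix ι ι ℝ))) - cgrad M (L ^ m * L ^ k) T'))ᵀ (cgrad M (L ^ m * L ^ k) (fun (_ : Fin (d + 1)) (_ : Tor (fine (L ^ m * L ^ k) M)) => (1 : Matrix ι ι ℝ))), Matrix.mulVecLin_mul (cGreen M (L ^ m * L ^ k) (fun (_ : Fin (d + 1)) (_ : Tor (fine (L ^ m * L ^ k) M)) => (1 : Matrix ι ι ℝ)) a') (sDiag M (L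 ^ m * L ^ k) (fun z => ∑ μ, ((fun ν x => (((L ^ m * L ^ k : ℕ) : ℝ)) • ((1 : Matrix ι ι ℝ) - T' ν x)) μ (z - unitVec (fine (L ^ m * L ^ k) M) μ))ᵀ * (fun ν x => (((L ^ m * L ^ k : ℕ) : ℝ)) • ((1 : Matrix ι ι ℝ) - T' ν x)) μ (z - unitVec (fine (L ^ m * L ^ k) M) μ))), Matrix.mulVecLin_mul (cGreen M (L ^ m * L ^ k) (fun (_ : Fin (d + 1)) (_ : Tor (fine (L ^ m * L ^ k) M)) => (1 : Matrix ι ι ℝ)) a') (a' • (((csavg M (L ^ m * L ^ k) (fun (_ : Fin (d + 1)) (_ : Tor (fine (L ^ m * L ^ k) M)) => (1 : Matrix ι ι ℝ))))ᵀ * (csavg M (L ^ m * L ^ k) (fun (_ : Fin (d + 1)) (_ : Tor (fine (L ^ m * L ^ k) M)) => (1 : Matrix ι ι ℝ))) - ((csavg M (L ^ m * L ^ k) T'))ᵀ * (csavg M (L ^ m * L ^ k) T'))), hTL', LinearMap.comp_sub,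
      ← LinearMap.comp_assoc, ← Matrix.mulVecLin_mul (cGreen M (L ^ m * L ^ k) (fun (_ : Fin (d + 1)) (_ : Tor (fine (L ^ m * L ^ k) M)) => (1 : Matrix ι ι ℝ)) a') ((cgrad M (L ^ m * L ^ k) (fun (_ : Fin (d + 1)) (_ : Tor (fine (L ^ m * L ^ k) M)) => (1 : Matrix ι ι ℝ))))ᵀ]
  -- ### the source of the defect's fixed point: `𝔇(G′(1)′, G′(1)) + 𝔇(K′, K)·G′(T)`
  have hSrc : HasMaj (BlockNorm.ofBlocks (unitTorusGeo L k M) (liftBlk (blockOf (L ^ k) M) ι)) (BlockNorm.ofBlocks (unitTorusGeo L k M) (liftBlk (blockOf (L ^ m * L ^ k) M) ι)) (idef (pull (liftMap (kingPr L k m M) ι)) (pull (liftMap (kingPr L k m M) ι)) (Matrix.mulVecLin (cGreen M (L ^ m * L ^ k) (fun (_ : Fin (d + 1)) (_ : Tor (fine (L ^ m * L ^ k) M)) => (1 : Matrix ι ι ℝ)) a')) (Matrix.mulVecLin (cGreen M (L ^ k) (fun (_ : Fin (d + 1)) (_ : Tor (fine (L ^ k) M)) => (1 : Matrix ι ι ℝ))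 a)) + idef (pull (liftMap (kingPr L k m M) ι)) (pull (liftMap (kingPr L k m M) ι)) (Matrix.mulVecLin ((cGreen M (L ^ m * L ^ k) (fun (_ : Fin (d + 1)) (_ : Tor (fine (L ^ m * L ^ k) M)) => (1 : Matrix ι ι ℝ)) a') * (claplA M (L ^ m * L ^ k) (fun (_ : Fin (d + 1)) (_ : Tor (fine (L ^ m * L ^ k) M)) => (1 : Matrix ι ι ℝ)) a' - claplA M (L ^ m * L ^ k) T' a'))) (Matrix.mulVecLin ((cGreen M (L ^ k) (fun (_ : Fin (d + 1)) (_ : Tor (fine (L ^ k) M)) => (1 : Matrix ι ι ℝ)) a) * (claplA M (L ^ k) (fun (_ : Fin (d + 1)) (_ : Tor (fine (L ^ k) M)) => (1 : Matrix ι ι ℝ)) a - claplA M (L ^ k) T a))) ∘ₗ Matrix.mulVecLin (cGreen M (L ^ k) T a))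
      (fun y y' => (εG + CA₁ * (ωN * (Real.exp (δ + s) * CX * c) + ((((L ^ k : ℕ) : ℝ)))⁻¹ * ((((L ^ m * L ^ k : ℕ) : ℝ)) * ρ₁) * CY) * c + εA * (((((L ^ k : ℕ) : ℝ)) * ρ * Real.exp (δ + s)) * CX * c) * c + CG₁ * (ωV * CX) * c + εG * ((((d : ℝ) + 1) * (((L ^ k : ℕ) : ℝ)) * ((((L ^ k : ℕ) : ℝ)) * lam)) * CX) * c + CA₁ * (ωN * CX) * c + εA * (((((L ^ k : ℕ) : ℝ)) * ρ) * CX) * c + CG₁ * (ωm * CX) * c + εG * ((((d : ℝ) + 1) * (((((L ^ k : ℕ) : ℝ)) * ρ) * ((((L ^ k : ℕ) : ℝ)) * ρ))) * CX) * c + CG₁ * (φQ * CX) * c + εG * ((|a| * (((((L ^ k : ℕ) : ℝ)) ^ (d + 1))⁻¹ * (σ * τ + σ))) * CX) * c) * Real.exp (-((δ - 2 * s) * tdistT M y y'))) := by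
    have hexp : idef (pull (liftMap (kingPr L k m M) ι)) (pull (liftMap (kingPr L k m M) ι)) (Matrix.mulVecLin ((cGreen M (L ^ m * L ^ k) (fun (_ : Fin (d + 1)) (_ : Tor (fine (L ^ m * L ^ k) M)) => (1 : Matrix ι ι ℝ)) a') * (claplA M (L ^ m * L ^ k) (fun (_ : Fin (d + 1)) (_ : Tor (fine (L ^ m * L ^ k) M)) => (1 : Matrix ι ι ℝ)) a' - claplA M (L ^ m * L ^ k) T' a'))) (Matrix.mulVecLin ((cGreen M (L ^ k) (fun (_ : Fin (d + 1)) (_ : Tor (fine (L ^ k) M)) => (1 : Matrix ι ι ℝ)) a) * (claplA M (L ^ k) (fun (_ : Fin (d + 1)) (_ : Tor (fine (L ^ k) M)) => (1 : Matrix ι ι ℝ)) a - claplA M (L ^ k) T a))) ∘ₗ Matrix.mulVecLin (cGreen M (L ^ k) T a) =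
        (Matrix.mulVecLin ((cGreen M (L ^ m * L ^ k) (fun (_ : Fin (d + 1)) (_ : Tor (fine (L ^ m * L ^ k) M)) => (1 : Matrix ι ι ℝ)) a') * ((cgrad M (L ^ m * L ^ k) (fun (_ : Fin (d + 1)) (_ : Tor (fine (L ^ m * L ^ k) M)) => (1 : Matrix ι ι ℝ))))ᵀ) ∘ₗ (idef (pull (liftMap (kingPr L k m M) ι)) (pull (liftMap (kingPrV L k m M) ι)) (Matrix.mulVecLin ((cgrad M (L ^ m * L ^ k) (fun (_ : Fin (d + 1)) (_ : Tor (fine (L ^ m * L ^ k) M)) => (1 : Matrix ι ι ℝ))) - cgrad M (L ^ m * L ^ k) T')) (Matrix.mulVecLin ((cgrad M (L ^ k) (fun (_ : Fin (d + 1)) (_ : Tor (fine (L ^ k) M)) => (1 : Matrix ι ι ℝ))) - cgrad M (L ^ k) T)) ∘ₗ Matrix.mulVecLin (cGreen M (L ^ k) T a))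
          + idef (pull (liftMap (kingPrV L k m M) ι)) (pull (liftMap (kingPr L k m M) ι)) (Matrix.mulVecLin ((cGreen M (L ^ m * L ^ k) (fun (_ : Fin (d + 1)) (_ : Tor (fine (L ^ m * L ^ k) M)) => (1 : Matrix ι ι ℝ)) a') * ((cgrad M (L ^ m * L ^ k) (fun (_ : Fin (d + 1)) (_ : Tor (fine (L ^ m * L ^ k) M)) => (1 : Matrix ι ι ℝ))))ᵀ)) (Matrix.mulVecLin ((cGreen M (L ^ k) (fun (_ : Fin (d + 1)) (_ : Tor (fine (L ^ k) M)) => (1 : Matrix ι ι ℝ)) a) * ((cgrad M (L ^ k) (fun (_ : Fin (d + 1)) (_ : Tor (fine (L ^ k) M)) => (1 : Matrix ι ι ℝ))))ᵀ)) ∘ₗ (Matrix.mulVecLin ((cgrad M (L ^ k) (fun (_ : Fin (d + 1)) (_ : Tor (fine (L ^ k) M)) => (1 : Matrix ι ι ℝ))) - cgrad M (L ^ k) T) ∘ₗ Matrix.mulVecLin (cGreen M (L ^ k) T a)))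
        + ((Matrix.mulVecLin (cGreen M (L ^ m * L ^ k) (fun (_ : Fin (d + 1)) (_ : Tor (fine (L ^ m * L ^ k) M)) => (1 : Matrix ι ι ℝ)) a') ∘ₗ (idef (pull (liftMap (kingPr L k m M) ι)) (pull (liftMap (kingPr L k m M) ι)) (Matrix.mulVecLin (sDiag M (L ^ m * L ^ k) (fun z => (bDiv M (L ^ m * L ^ k) (fun ν x => (((L ^ m * L ^ k : ℕ) : ℝ)) • ((1 : Matrix ι ι ℝ) - T' ν x)) z)ᵀ))) (Matrix.mulVecLin (sDiag M (L ^ k) (fun z => (bDiv M (L ^ k) (fun ν x => (((L ^ k : ℕ) : ℝ)) • ((1 : Matrix ι ι ℝ) - T ν x)) z)ᵀ))) ∘ₗ Matrix.mulVecLin (cGreen M (L ^ k) T a))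
            + idef (pull (liftMap (kingPr L k m M) ι)) (pull (liftMap (kingPr L k m M) ι)) (Matrix.mulVecLin (cGreen M (L ^ m * L ^ k) (fun (_ : Fin (d + 1)) (_ : Tor (fine (L ^ m * L ^ k) M)) => (1 : Matrix ι ι ℝ)) a')) (Matrix.mulVecLin (cGreen M (L ^ k) (fun (_ : Fin (d + 1)) (_ : Tor (fine (L ^ k) M)) => (1 : Matrix ι ι ℝ)) a)) ∘ₗ (Matrix.mulVecLin (sDiag M (L ^ k) (fun z => (bDiv M (L ^ k) (fun ν x => (((L ^ k : ℕ) : ℝ)) • ((1 : Matrix ι ι ℝ) - T ν x)) z)ᵀ)) ∘ₗ Matrix.mulVecLin (cGreen M (L ^ k) T a)))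
          - (Matrix.mulVecLin ((cGreen M (L ^ m * L ^ k) (fun (_ : Fin (d + 1)) (_ : Tor (fine (L ^ m * L ^ k) M)) => (1 : Matrix ι ι ℝ)) a') * ((cgrad M (L ^ m * L ^ k) (fun (_ : Fin (d + 1)) (_ : Tor (fine (L ^ m * L ^ k) M)) => (1 : Matrix ι ι ℝ))))ᵀ) ∘ₗ (idef (pull (liftMap (kingPr L k m M) ι)) (pull (liftMap (kingPrV L k m M) ι)) (Matrix.mulVecLin (bContr M (L ^ m * L ^ k) (fun ν x => (((L ^ m * L ^ k : ℕ) : ℝ)) • ((1 : Matrix ι ι ℝ) - T' ν x)))ᵀ) (Matrix.mulVecLin (bContr M (L ^ k) (fun ν x => (((L ^ k : ℕ) : ℝ)) • ((1 : Matrix ι ι ℝ) - T ν x)))ᵀ) ∘ₗ Matrix.mulVecLin (cGreen M (L ^ k) T a))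
            + idef (pull (liftMap (kingPrV L k m M) ι)) (pull (liftMap (kingPr L k m M) ι)) (Matrix.mulVecLin ((cGreen M (L ^ m * L ^ k) (fun (_ : Fin (d + 1)) (_ : Tor (fine (L ^ m * L ^ k) M)) => (1 : Matrix ι ι ℝ)) a') * ((cgrad M (L ^ m * L ^ k) (fun (_ : Fin (d + 1)) (_ : Tor (fine (L ^ m * L ^ k) M)) => (1 : Matrix ι ι ℝ))))ᵀ)) (Matrix.mulVecLin ((cGreen M (L ^ k) (fun (_ : Fin (d + 1)) (_ : Tor (fine (L ^ k) M)) => (1 : Matrix ι ι ℝ)) a) * ((cgrad M (L ^ k) (fun (_ : Fin (d + 1)) (_ : Tor (fine (L ^ k) M)) => (1 : Matrix ι ι ℝ))))ᵀ)) ∘ₗ (Matrix.mulVecLin (bContr M (L ^ k) (fun ν x => (((L ^ k : ℕ) : ℝ)) • ((1 : Matrix ι ι ℝ) - T ν x)))ᵀ ∘ₗ Matrix.mulVecLin (cGreen M (L ^ k) T a))))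
        - (Matrix.mulVecLin (cGreen M (L ^ m * L ^ k) (fun (_ : Fin (d + 1)) (_ : Tor (fine (L ^ m * L ^ k) M)) => (1 : Matrix ι ι ℝ)) a') ∘ₗ (idef (pull (liftMap (kingPr L k m M) ι)) (pull (liftMap (kingPr L k m M) ι)) (Matrix.mulVecLin (sDiag M (L ^ m * L ^ k) (fun z => ∑ μ, ((fun ν x => (((L ^ m * L ^ k : ℕ) : ℝ)) • ((1 : Matrix ι ι ℝ) - T' ν x)) μ (z - unitVec (fine (L ^ m * L ^ k) M) μ))ᵀ * (fun ν x => (((L ^ m * L ^ k : ℕ) : ℝ)) • ((1 : Matrix ι ι ℝ) - T' ν x)) μ (z - unitVec (fine (L ^ m * L ^ k) M) μ)))) (Matrix.mulVecLin (sDiag M (L ^ k) (fun z => ∑ μ, ((fun ν x => (((L ^ k : ℕ) : ℝ)) • ((1 : Matrix ι ι ℝ) - T ν x)) μ (z - unitVec (fine (L ^ k) M) μ))ᵀ * (fun ν x => (((L ^ k : ℕ) : ℝ)) • ((1 : Matrix ι ι ℝ) - T ν x)) μ (z - unitVec (fine (L ^ k) M) μ)))) ∘ₗ Matrix.mulVecLin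 (cGreen M (L ^ k) T a))
            + idef (pull (liftMap (kingPr L k m M) ι)) (pull (liftMap (kingPr L k m M) ι)) (Matrix.mulVecLin (cGreen M (L ^ m * L ^ k) (fun (_ : Fin (d + 1)) (_ : Tor (fine (L ^ m * L ^ k) M)) => (1 : Matrix ι ι ℝ)) a')) (Matrix.mulVecLin (cGreen M (L ^ k) (fun (_ : Fin (d + 1)) (_ : Tor (fine (L ^ k) M)) => (1 : Matrix ι ι ℝ)) a)) ∘ₗ (Matrix.mulVecLin (sDiag M (L ^ k) (fun z => ∑ μ, ((fun ν x => (((L ^ k : ℕ) : ℝ)) • ((1 : Matrix ι ι ℝ) - T ν x)) μ (z - unitVec (fine (L ^ k) M) μ))ᵀ * (fun ν x => (((L ^ k : ℕ) : ℝ)) • ((1 : Matrix ι ι ℝ) - T ν x)) μ (z - unitVec (fine (L ^ k) M) μ))) ∘ₗ Matrix.mulVecLin (cGreen M (L ^ k) T a)))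
        + (Matrix.mulVecLin (cGreen M (L ^ m * L ^ k) (fun (_ : Fin (d + 1)) (_ : Tor (fine (L ^ m * L ^ k) M)) => (1 : Matrix ι ι ℝ)) a') ∘ₗ (idef (pull (liftMap (kingPr L k m M) ι)) (pull (liftMap (kingPr L k m M) ι)) (Matrix.mulVecLin (a' • (((csavg M (L ^ m * L ^ k) (fun (_ : Fin (d + 1)) (_ : Tor (fine (L ^ m * L ^ k) M)) => (1 : Matrix ι ι ℝ))))ᵀ * (csavg M (L ^ m * L ^ k) (fun (_ : Fin (d + 1)) (_ : Tor (fine (L ^ m * L ^ k) M)) => (1 : Matrix ι ι ℝ))) - ((csavg M (L ^ m * L ^ k) T'))ᵀ * (csavg M (L ^ m * L ^ k) T')))) (Matrix.mulVecLin (a • (((csavg M (L ^ k) (fun (_ : Fin (d + 1)) (_ : Tor (fine (L ^ k) M)) => (1 : Matrix ι ι ℝ))))ᵀ * (csavg M (L ^ k) (fun (_ : Fin (d + 1)) (_ : Tor (fine (L ^ k) M)) => (1 : Matrix ι ι ℝ))) - ((csavg M (L ^ k) T))ᵀ * (csavg M (L ^ k) T)))) ∘ₗ Matrix.mulVecLin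 (cGreen M (L ^ k) T a))
            + idef (pull (liftMap (kingPr L k m M) ι)) (pull (liftMap (kingPr L k m M) ι)) (Matrix.mulVecLin (cGreen M (L ^ m * L ^ k) (fun (_ : Fin (d + 1)) (_ : Tor (fine (L ^ m * L ^ k) M)) => (1 : Matrix ι ι ℝ)) a')) (Matrix.mulVecLin (cGreen M (L ^ k) (fun (_ : Fin (d + 1)) (_ : Tor (fine (L ^ k) M)) => (1 : Matrix ι ι ℝ)) a)) ∘ₗ (Matrix.mulVecLin (a • (((csavg M (L ^ k) (fun (_ : Fin (d + 1)) (_ : Tor (fine (L ^ k) M)) => (1 : Matrix ι ι ℝ))))ᵀ * (csavg M (L ^ k) (fun (_ : Fin (d + 1)) (_ : Tor (fine (L ^ k) M)) => (1 : Matrix ι ι ℝ))) - ((csavg M (L ^ k) T))ᵀ * (csavg M (L ^ k) T))) ∘ₗ Matrix.mulVecLin (cGreen M (L ^ k) T a))) := by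
      rw [hKn, hKn']
      simp only [idef_add, idef_sub]
      rw [idef_comp (pull (liftMap (kingPr L k m M) ι)) (pull (liftMap (kingPrV L k m M) ι)) (pull (liftMap (kingPr L k m M) ι)) (Matrix.mulVecLin ((cGreen M (L ^ m * L ^ k) (fun (_ : Fin (d + 1)) (_ : Tor (fine (L ^ m * L ^ k) M)) => (1 : Matrix ι ι ℝ)) a') * ((cgrad M (L ^ m * L ^ k) (fun (_ : Fin (d + 1)) (_ : Tor (fine (L ^ m * L ^ k) M)) => (1 : Matrix ι ι ℝ))))ᵀ)) (Matrix.mulVecLin ((cgrad M (L ^ m * L ^ k) (fun (_ : Fin (d + 1)) (_ : Tor (fine (L ^ m * L ^ k) M)) => (1 : Matrix ι ι ℝ))) - cgrad M (L ^ m * L ^ k) T')) (Matrix.mulVecLin ((cGreen M (L ^ k) (fun (_ : Fin (d + 1)) (_ : Tor (fine (L ^ k) M)) => (1 : Matrix ι ι ℝ)) a) * ((cgrad M (L ^ k) (fun (_ : Fin (d + 1)) (_ : Tor (fine (L ^ k) M)) => (1 : Matrix ι ι ℝ))))ᵀ)) (Matrix.mulVecLin ((cgrad M (L ^ k) (fun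 (_ : Fin (d + 1)) (_ : Tor (fine (L ^ k) M)) => (1 : Matrix ι ι ℝ))) - cgrad M (L ^ k) T)),
        idef_comp (pull (liftMap (kingPr L k m M) ι)) (pull (liftMap (kingPr L k m M) ι)) (pull (liftMap (kingPr L k m M) ι)) (Matrix.mulVecLin (cGreen M (L ^ m * L ^ k) (fun (_ : Fin (d + 1)) (_ : Tor (fine (L ^ m * L ^ k) M)) => (1 : Matrix ι ι ℝ)) a')) (Matrix.mulVecLin (sDiag M (L ^ m * L ^ k) (fun z => (bDiv M (L ^ m * L ^ k) (fun ν x => (((L ^ m * L ^ k : ℕ) : ℝ)) • ((1 : Matrix ι ι ℝ) - T' ν x)) z)ᵀ))) (Matrix.mulVecLin (cGreen M (L ^ k) (fun (_ : Fin (d + 1)) (_ : Tor (fine (L ^ k) M)) => (1 : Matrix ι ι ℝ)) a)) (Matrix.mulVecLin (sDiag M (L ^ k) (fun z => (bDiv M (L ^ k) (fun ν x => (((L ^ k : ℕ) : ℝ)) • ((1 : Matrix ι ι ℝ) - T ν x)) z)ᵀ))),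
        idef_comp (pull (liftMap (kingPr L k m M) ι)) (pull (liftMap (kingPrV L k m M) ι)) (pull (liftMap (kingPr L k m M) ι)) (Matrix.mulVecLin ((cGreen M (L ^ m * L ^ k) (fun (_ : Fin (d + 1)) (_ : Tor (fine (L ^ m * L ^ k) M)) => (1 : Matrix ι ι ℝ)) a') * ((cgrad M (L ^ m * L ^ k) (fun (_ : Fin (d + 1)) (_ : Tor (fine (L ^ m * L ^ k) M)) => (1 : Matrix ι ι ℝ))))ᵀ)) (Matrix.mulVecLin (bContr M (L ^ m * L ^ k) (fun ν x => (((L ^ m * L ^ k : ℕ) : ℝ)) • ((1 : Matrix ι ι ℝ) - T' ν x)))ᵀ) (Matrix.mulVecLin ((cGreen M (L ^ k) (fun (_ : Fin (d + 1)) (_ : Tor (fine (L ^ k) M)) => (1 : Matrix ι ι ℝ)) a) * ((cgrad M (L ^ k) (fun (_ : Fin (d + 1)) (_ : Tor (fine (L ^ k) M)) => (1 : Matrix ι ι ℝ))))ᵀ)) (Matrix.mulVecLin (bContr M (L ^ k) (fun ν x => (((L ^ k : ℕ) : ℝ)) • ((1 : Matrix ι ι ℝ) - T ν x)))ᵀ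),
        idef_comp (pull (liftMap (kingPr L k m M) ι)) (pull (liftMap (kingPr L k m M) ι)) (pull (liftMap (kingPr L k m M) ι)) (Matrix.mulVecLin (cGreen M (L ^ m * L ^ k) (fun (_ : Fin (d + 1)) (_ : Tor (fine (L ^ m * L ^ k) M)) => (1 : Matrix ι ι ℝ)) a')) (Matrix.mulVecLin (sDiag M (L ^ m * L ^ k) (fun z => ∑ μ, ((fun ν x => (((L ^ m * L ^ k : ℕ) : ℝ)) • ((1 : Matrix ι ι ℝ) - T' ν x)) μ (z - unitVec (fine (L ^ m * L ^ k) M) μ))ᵀ * (fun ν x => (((L ^ m * L ^ k : ℕ) : ℝ)) • ((1 : Matrix ι ι ℝ) - T' ν x)) μ (z - unitVec (fine (L ^ m * L ^ k) M) μ)))) (Matrix.mulVecLin (cGreen M (L ^ k) (fun (_ : Fin (d + 1)) (_ : Tor (fine (L ^ k) M)) => (1 : Matrix ι ι ℝ)) a)) (Matrix.mulVecLin (sDiag M (L ^ k) (fun z => ∑ μ, ((fun ν x => (((L ^ k : ℕ) : ℝ)) • ((1 : Matrix ι ι ℝ) - T ν x)) μ (z - unitVec (fine (L ^ k) M) μ))ᵀ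 * (fun ν x => (((L ^ k : ℕ) : ℝ)) • ((1 : Matrix ι ι ℝ) - T ν x)) μ (z - unitVec (fine (L ^ k) M) μ)))),
        idef_comp (pull (liftMap (kingPr L k m M) ι)) (pull (liftMap (kingPr L k m M) ι)) (pull (liftMap (kingPr L k m M) ι)) (Matrix.mulVecLin (cGreen M (L ^ m * L ^ k) (fun (_ : Fin (d + 1)) (_ : Tor (fine (L ^ m * L ^ k) M)) => (1 : Matrix ι ι ℝ)) a')) (Matrix.mulVecLin (a' • (((csavg M (L ^ m * L ^ k) (fun (_ : Fin (d + 1)) (_ : Tor (fine (L ^ m * L ^ k) M)) => (1 : Matrix ι ι ℝ))))ᵀ * (csavg M (L ^ m * L ^ k) (fun (_ : Fin (d + 1)) (_ : Tor (fine (L ^ m * L ^ k) M)) => (1 : Matrix ι ι ℝ))) - ((csavg M (L ^ m * L ^ k) T'))ᵀ * (csavg M (L ^ m * L ^ k) T')))) (Matrix.mulVecLin (cGreen M (L ^ k) (fun (_ : Fin (d + 1)) (_ : Tor (fine (L ^ k) M)) => (1 : Matrix ι ι ℝ)) a)) (Matrix.mulVecLin (a • (((csavg M (L ^ k) (fun (_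 : Fin (d + 1)) (_ : Tor (fine (L ^ k) M)) => (1 : Matrix ι ι ℝ))))ᵀ * (csavg M (L ^ k) (fun (_ : Fin (d + 1)) (_ : Tor (fine (L ^ k) M)) => (1 : Matrix ι ι ℝ))) - ((csavg M (L ^ k) T))ᵀ * (csavg M (L ^ k) T))))]
      simp only [LinearMap.add_comp, LinearMap.sub_comp, LinearMap.comp_assoc]
    rw [hexp]
    refine ((hDG.of_rate_le hd hεG (by linarith : δ - 2 * s ≤ δ)).add
      ((((w1a.add w1b).add ((w2a.add w2b).sub (w2c.add w2d))).sub (w3a.add w3b)).add (w4a.add w4b))).mono fun y y' => le_of_eq ?_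
    ring
  -- ### the fixed points, the a-priori bound, the Neumann series on the fine step
  have hfix := mulVecLin_cGreen_eq_one_add_step_comp M (L ^ k) hT ha
  have hfix' := mulVecLin_cGreen_eq_one_add_step_comp M (L ^ m * L ^ k) hT' ha'
  have hfixD := idef_fix (pull (liftMap (kingPr L k m M) ι)) (pull (liftMap (kingPr L k m M) ι)) hfix hfix'
  have hK' := hasMaj_cGreen_one_mul_claplA_sub M (L ^ m * L ^ k) L k T' a' hs hsδ hrow hc hCG₁ hCA₁ hρ₁0 hlam₁0 hσ₁0 hτ₁0 hρr' hρc' hlamc' hσr' hσc' hτr' hG1' hA1'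
  obtain ⟨M₀, hM₀, hap⟩ := exists_const_hasMaj_ofBlocks (g := unitTorusGeo L k M) (liftBlk (blockOf (L ^ k) M) ι) (liftBlk (blockOf (L ^ m * L ^ k) M) ι)
    (idef (pull (liftMap (kingPr L k m M) ι)) (pull (liftMap (kingPr L k m M) ι)) (Matrix.mulVecLin (cGreen M (L ^ m * L ^ k) T' a')) (Matrix.mulVecLin (cGreen M (L ^ k) T a)))
  have hθ0 : 0 ≤ (CA₁ * ((((L ^ m * L ^ k : ℕ) : ℝ)) * ρ₁ * Real.exp δ) * c + CG₁ * (((d : ℝ) + 1) * (((L ^ m * L ^ k : ℕ) : ℝ)) * ((((L ^ m * L ^ k : ℕ) : ℝ)) * lam₁)) + CA₁ * ((((L ^ m * L ^ k : ℕ) : ℝ)) * ρ₁) + CG₁ * (((((L ^ m * L ^ k : ℕ) : ℝ)) * ((d + 1 : ℕ) * ρ₁) * Real.exp (δ + s)) * ((((L ^ m * L ^ k : ℕ) : ℝ)) * ρ₁ * Real.exp (δ + s)) * c) * c + |a'| * (((((L ^ m * L ^ k : ℕ) : ℝ)) ^ (d + 1))⁻¹ * CG₁ * (σ₁ * τ₁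 + σ₁))) := by positivity
  have hE0 : 0 ≤ (εG + CA₁ * (ωN * (Real.exp (δ + s) * CX * c) + ((((L ^ k : ℕ) : ℝ)))⁻¹ * ((((L ^ m * L ^ k : ℕ) : ℝ)) * ρ₁) * CY) * c + εA * (((((L ^ k : ℕ) : ℝ)) * ρ * Real.exp (δ + s)) * CX * c) * c + CG₁ * (ωV * CX) * c + εG * ((((d : ℝ) + 1) * (((L ^ k : ℕ) : ℝ)) * ((((L ^ k : ℕ) : ℝ)) * lam)) * CX) * c + CA₁ * (ωN * CX) * c + εA * (((((L ^ k : ℕ) : ℝ)) * ρ) * CX) * c + CG₁ * (ωm * CX) * c + εG * ((((d : ℝ) + 1) * (((((L ^ k : ℕ) : ℝ)) * ρ) * ((((L ^ k : ℕ) : ℝ)) * ρ))) * CX) * c + CG₁ * (φQ * CX) * c + εG * ((|a| * (((((L ^ k : ℕ) : ℝ)) ^ (d + 1))⁻¹ * (σ * τ + σ))) * CX) * c) := by positivity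
  have hq'' : (BlockNorm.ofBlocks (unitTorusGeo L k M) (liftBlk (blockOf (L ^ m * L ^ k) M) ι)).κ * (CA₁ * ((((L ^ m * L ^ k : ℕ) : ℝ)) * ρ₁ * Real.exp δ) * c + CG₁ * (((d : ℝ) + 1) * (((L ^ m * L ^ k : ℕ) : ℝ)) * ((((L ^ m * L ^ k : ℕ) : ℝ)) * lam₁)) + CA₁ * ((((L ^ m * L ^ k : ℕ) : ℝ)) * ρ₁) + CG₁ * (((((L ^ m * L ^ k : ℕ) : ℝ)) * ((d + 1 : ℕ) * ρ₁) * Real.exp (δ + s)) * ((((L ^ m * L ^ k : ℕ) : ℝ)) * ρ₁ * Real.exp (δ + s)) * c) * c + |a'| * (((((L ^ m * L ^ k : ℕ) : ℝ)) ^ (d + 1))⁻¹ * CG₁ * (σ₁ * τ₁ + σ₁))) * c < 1 := by rw [hκS1, one_mul]; exact hq'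
  have key := neumann_majorant (b₁ := (BlockNorm.ofBlocks (unitTorusGeo L k M) (liftBlk (blockOf (L ^ k) M) ι))) (b₂ := (BlockNorm.ofBlocks (unitTorusGeo L k M) (liftBlk (blockOf (L ^ m * L ^ k) M) ι))) (ρ := δ - 2 * s) htri hd hrow hθ0 hE0 hM₀ (by linarith) (by linarith) hK' hSrc hfixD hap hq''
  refine key.mono fun y y' => le_of_eq ?_
  rw [hκS1, one_mul]

end Defect

end Summit.QuantumFields.YangMills.BalabanUVNodes.N15.CovLandau

end
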